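import Literature.MathematicalPhysics.QuantumFieldTheory.Balaban1983to89.B6QGQTestBumpsKLevelV1L0
import HarnessLib
import Literature.MathematicalPhysics.QuantumFieldTheory.Balaban1983to89.B6Cover236MultiLevelBlocksL0
import Literature.MathematicalPhysics.QuantumFieldTheory.Balaban1983to89.B6Geom246MultiLevelTorusL0
import Literature.MathematicalPhysics.QuantumFieldTheory.Balaban1983to89.B6GlobalChartV1L0
import Literature.MathematicalPhysics.QuantumFieldTheory.Balaban1983to89.B6Ineq2142KLevelV1L0
import Literature.MathematicalPhysics.QuantumFieldTheory.Balaban1983to89.B6MultiLevelTorusOperatorL0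
import Literature.MathematicalPhysics.QuantumFieldTheory.Balaban1983to89.B6Prop27KLevelV1L0
import Literature.MathematicalPhysics.QuantumFieldTheory.Balaban1983to89.B6QGQCoerciveKLevelV1

/-!
# `Balaban1983to89.B6QGQCoerciveKLevelV1L0` — LEVEL-0 TWIN (programme G-F3′-L0, director-ym LINE №27 / UV3-NODE §24.5; plan `lit-balaban-r03/G-F3L0-PLAN.md`) of `B6QGQCoerciveKLevelV1`:
the same declarations, SAME NAMES AND STATEMENTS, for nested families WITH print's region `Λ₀ = T ∖ Ω₁` ADMITTED (structures
`B6MultiLevelBoxOperatorL0.Domains` / `B6MultiLevelTorusOperatorL0.TDomains`: levels `0, …, k`, the level-`0` block a single site, `Q′₀ = id`,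
finite weight `a₀` — print p.225 (2.14) «Σ_{j=0}^k … (Q′₀λ)(x) = λ(x), x ∈ Λ₀», p.229 «taking a sequence (2.1) … smallest possible domains B^j(Λ_j),
and considering the operator Δ_a defined by (2.19), (2.20) for this sequence»).  Every `D`-free object is the lineage's, consumed BY NAME; no existing
module is touched; no fact is minted.  JOINT J7 IN THIS FILE: with part 1's EFFECTIVE tent radius `r̂ = max(r, 1)` (`= r` at levels `≥ 1`, `= 1`
for a level-0 index bond, whose bump is the indicator of the bond itself) every lineage statement holds VERBATIM except the four tent numerics
that are false for the level-0 indicator, which carry the level hypothesis `1 ≤ j(i)` explicitly: `tauL_le_rad`, `tauL_last`, `tt2_le`,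
`pow_le_ten_mul_rad`, `grad_bump_le'` (+ `4 ≤ ℓ` where `r̂ = r` is used); `tsumL_ge` loses its guards; `gpart_hom` gets the level-0 branch
`gpart_hom_of_lvl_eq_zero` (`W_i c_f² = 1`, `Σ(Δφ_i)² ≤ 2(d+1)`, `m_i ≥ ½·8^{−d}`: the constant `C_∇(d)` is ample); new helpers `tauL_le_erad`,
`tauL_last_le_one`, `tt2_le_erad`, `tsumL_ge_erad`; the binders `(hk1 : 1 ≤ k)` are dropped throughout (callers drop the argument), in particular in
`qgq_coercive_kLevel`.  Ported by p34 g114 (r03 g36 delegation 2026-08-27T20:36:03Z).  Unit `lit-balaban-r03` (B6 fold owner, r03 gen 36); referee ref-4.  THE TWIN'S DOCUMENTATION FOLLOWS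
VERBATIM (its «levels 1 … k» / «Ω₁ = X» sentences describe the twin; here `j` runs from `0` and `Ω₁` may be a proper subset).

# `Balaban1983to89.B6QGQCoerciveKLevelV1` — T. Bałaban, *Propagators and renormalization transformations for lattice gauge theories. II*,
Comm. Math. Phys. **96** (1984) 223–250 [Balaban1984PropagatorsII], **the lower bound (2.147) «⟨B,(QGQ*)B⟩ ≥ γ₀‖B‖²» for `QGQ*` AT k LEVELS
in the global level-weighted form `γ₀·Σ_i Λ_i² v_i² ≤ ⟪Q*v, G Q*v⟫` (`γ₀ = γ₀(d, L, b₁)` independent of `k`)**, and with it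
**Proposition 2.7 (2.149) at k levels WITHOUT the coercivity hypothesis** of `B6Prop27KLevelV1L0.prop27_kLevel` (ROUTE W file W1, part 2 of 2;
B6-CLOSURE §5 item 17, design v2).

HONEST FRAMING (programme rule): statement-level skeleton of published theorems with citation tags; proofs where landed; nothing here
is a claim about the Yang–Mills mass gap.  The print's argument for (2.147) is
«The operator C is an inverse to the operator of the quadratic form (2.120), hence it is bounded from below by an inverse of an
upper bound of this form. Taking into account that ‖B₁‖² is bounded from below by const‖B‖², we get ⟨B,(QGQ*)B⟩ ≥ γ₀‖B‖² (2.147)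
with a positive constant γ₀ depending on d and L only» (p. 248); the proof below is OUR explicit realisation of
that lower bound on ROUTE V's torus model (`B6GlobalChartV1L0.domT`): the variational principle of part 1 («bounded from below by an inverse of
an upper bound of this form») plus integer tent test fields on the carrier blocks supplying the upper bound — every constant is explicit and
k-uniform, no hypothesis of the print is dropped, and the weights are exactly the band (2.16) (`GlobalBand`, upper half).

## WHAT THIS FILE CERTIFIES (kernel-checked, sorry-free, standard axioms)

* (part 1, `B6QGQTestBumpsKLevelV1`: the variational principle `inner_GE_ge_of_test`, the abstract assembly `qgq_coercive_of_test_map`,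
  the exact `Q`-weights on carrier blocks, the tent bumps `φ_i` (`τ(u) = max(0, r − |u − ctr|)`, `r = ⌊L^j/5⌋`; `τ_⊥(c) = min(c+1, L^j − c)`),
  their pairings `(Qφ_i)_{i′}` in closed form, `mass_eq`, `partner_le` (`≤ ¼`), `level_window`, the counts `≤ 2` / `≤ 2L^D`, `energy_le`,
  `grad_sq_le`, `qrow_sq_le`, `qenergy_bump_le`.)
* §6d–§6g the per-bond gradient majorant `bdiff_sq_le` and its Fubini evaluation `grad_bump_le`, the tent sums (`tsumL_ge ≥ r²/2`,
  `Tsum_ge ≥ L^{2j}/8`, `TT2_le`, `tt2_le`), `mass_mul`, and the homogeneity bounds **`gpart_hom`** (`Λ_i²c_f²·Σ(Δφ_i)² ≤ C_∇(d)·m_i²`,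
  `C_∇(d) = 2(1 + d/25)·8^{2d}·62500`) and **`qpart_hom`** (`Λ_i²·Σ_{i′}w_{i′}(Qφ_i)_{i′}² ≤ (25/8)b₁L^D·m_i²`).
* §7 `same_level_sum_le` (the same-level rows `≠ i` carry `≤ ¼` of the mass), `card_same_level_le ≤ 2`, the weighted row bounds
  `nu_pair_same_le`, `nu_pair_coarse_le` (`κ = (5/4)L^{−D}`), the test map `Φv = Σ_i v_i(Λ_i²/m_i)φ_i`, **`dominance`**
  (`⟪QΦv, v⟫ ≥ ⅛·ΣΛ_i²v_i²`: diagonal exactly `ΣΛ²v²`; same-level rows cost `≤ ⅛ + ¼`, coarse rows `≤ ¼ + (25/4)L^{−2} ≤ ¼ + ¼` by AM–GM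
  with `θ = 4`, using `L ≥ 5`), **`energy_Phi_le`** (`⟪Φv, Δ_aΦv⟫ ≤ C_E·ΣΛ²v²`, `C_E = 4D(D+2)C_∇ + 4D·L^D·(25/8)b₁L^D`),
  **`qgq_coercive_kLevel`** (`γ₀·Σ_iΛ_i²v_i² ≤ ⟪Q*v, GQ*v⟫`, `γ₀ = (1/8)²/C_E`), and **`prop27_kLevel_unconditional`** =
  `B6Prop27KLevelV1L0.prop27_kLevel` with `γ := γ₀(d, L, b₁)` and its hypothesis `hγ` discharged.

## HONEST SCOPE

Hypotheses of `qgq_coercive_kLevel`: ROUTE V's torus datum (`hN`, `D`, `hk`), `1 ≤ k`, `4 ≤ ℓ` (i.e. `L ≥ 5`, as in the k-level (2.142)),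
`2 ≤ R·M̂`, `c_f ≠ 0`, `0 < w_i ≤ b₁c_f²(L^D)^{j(i)}/(L^{j(i)})²` (the upper half of (2.16), `hwup_of_globalBand`); the torus periods
`2L^{m+K−n} ≥ 2` are automatic (`Params.one_lt_sitesPerDir`).  The constant `γ₀` is far from optimal (tents of radius `⌊L^j/5⌋`, AM–GM budget
`⅛`); only its independence of `k`, `m`, `K`, `M̂`, `R`, `c_f` matters downstream.  `prop27_kLevel_unconditional` keeps every other standing
side condition of `prop27_kLevel` verbatim (`2 ≤ k`, `M̂ = L^a ≥ 8`, `R ≥ 2L²`, `P′_μ ≥ 5`, placed cubes, the thresholds `M₂`, `N₁`).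
-/

namespace Literature.MathematicalPhysics.QuantumFieldTheory.Balaban1983to89.B6QGQCoerciveKLevelV1L0

open Literature.MathematicalPhysics.QuantumFieldTheory.Balaban1983to89.B6QGQTestBumpsKLevelV1 hiding QE_apply_eq_sum_qwt baseBlk_subset_other base_eq_src_of base_eq_tgt_of beta_eq_of_bump_ne_zero beta_mem_metBlocks_of_pair_ne_zero bump bumpFn bumpFn_nonneg bump_ne_zero_imp card_bump_support_le card_coarse_rows_le card_fine_seen_le card_key_le_one card_pair_support_le ctr ctr_caseA ctr_caseB ctr_fit ext_of_key five_mul_rad_le grad_sq_le level_window mass_eq mass_pos one_le_rad pair_eq_of_weight pair_eq_zero_of_dir_ne pair_eq_zero_of_disjoint pair_le pair_le' pair_nonneg pair_src pair_tgt partner_eq partner_le qenergy_bump_le qrow_sq_le qwt_eq_zero_of_dir_ne qwt_eq_zero_of_not_mem qwt_src qwt_tgt rad srcBlk sum_pair_le sum_pair_level_le sum_qwt_level_le tauL tauL_nonneg tsumL tsumL_pos witness_of_pair_ne_zero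
open Literature.MathematicalPhysics.QuantumFieldTheory.Balaban1983to89.B6QGQTestBumpsKLevelV1L0
open scoped InnerProductSpace
open LatticeFieldCalculus
open B6SectADomainsV1 (Domains)
open B6SectAOperatorsV1 (QE QsE BondIdx BondIdxSpace inner_QsE_left)
open B6SectAVectorModelV1 (GE deltaAE inner_GE_left deltaAE_GE inner_deltaAE_left inner_deltaAE_self_nonneg
  eq_zero_of_inner_deltaAE_self_eq_zero inner_GE_pos)
open BalabanImbrieJaffe1984to88.BIJ85AxialPropagator411 (BondSpace)
open Literature.MathematicalPhysics.QuantumFieldTheory.Balaban1983to89.B6QGQCoerciveKLevelV1 (tauT_step tauT_facts shift_mem_iff loc_eq_zero_of_enter TT2 TT2_le Tsum_ge Cgrad iterBlock_eq_of_mem iterBlock_unshift_eq amgm_same amgm_coarse kap Cen Cen_pos gam0 gam0_pos)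

noncomputable section

/-! ## §6d  The gradient energy of one bump -/

section Grad

open B5Eq118OneStroke (iterBlock iterBlockOf mem_iterBlock mem_iterBlock_iff)
open B6MultiLevelBoxOperator (N0)
open B6MultiLevelTorusOperatorL0 (TDomains)
open B6GlobalChartV1 (PV)
open B6GlobalChartV1L0 (domT)
open B6Ineq2142KLevelV1 (cQ)
open B6Ineq2142KLevelV1L0 (lvl lvl_le lvl_le_mK base)

variable {d ℓ m K : ℕ} {hd : 1 ≤ d + 1} {hL : Odd (ℓ + 1) ∧ 1 < ℓ + 1}
variable {Mh k R : ℕ} {P' : Fin (d + 1) → ℕ}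
variable (hN : ∀ μ, N0 ℓ Mh k P' μ = (PV d ℓ m K hd hL).sitesPerDir 0) (D : TDomains d ℓ Mh k P' R) (hk : k ≤ m + K)

/-- one-step tents are 1-Lipschitz: `|τ(u+1) − τ(u)| ≤ 1`. [cite: Balaban1984PropagatorsII, (2.147) p.248, bookkeeping] -/
theorem tauL_step (i : BondIdx (B6GlobalChartV1L0.domT hN D hk)) (u : ℕ) : |tauL hN D hk i (u + 1) - tauL hN D hk i u| ≤ 1 := by
  unfold tauL
  set c : ℝ := (ctr hN D hk i : ℝ)
  set r : ℝ := (erad hN D hk i : ℝ)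
  set a : ℝ := r - abs (((u + 1 : ℕ) : ℝ) - c)
  set b : ℝ := r - abs ((u : ℝ) - c)
  have h1 : abs (a - b) ≤ 1 := by
    have h := abs_abs_sub_abs_le ((u : ℝ) - c) (((u + 1 : ℕ) : ℝ) - c)
    have e : (u : ℝ) - c - ((((u + 1 : ℕ) : ℝ)) - c) = -1 := by push_cast; ring
    rw [e, abs_neg, abs_one] at h
    have e2 : a - b = abs ((u : ℝ) - c) - abs (((u + 1 : ℕ) : ℝ) - c) := by simp only [a, b]; ring
    rw [e2]; exact h
  calc abs (max 0 a - max 0 b) = abs (max a 0 - max b 0) := by rw [max_comm 0 a, max_comm 0 b]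
    _ ≤ abs (a - b) := abs_max_sub_max_le_abs a b 0
    _ ≤ 1 := h1

/-- `τ ≤ r̂` (LEVEL-0 TWIN: the effective radius). [cite: Balaban1984PropagatorsII, (2.147) p.248, bookkeeping] -/
theorem tauL_le_erad (i : BondIdx (domT hN D hk)) (u : ℕ) : tauL hN D hk i u ≤ erad hN D hk i := by
  unfold tauL; exact max_le (Nat.cast_nonneg _) (by linarith [abs_nonneg ((u : ℝ) - ctr hN D hk i)])

/-- `τ ≤ r` at levels `j ≥ 1` (LEVEL-0 TWIN, joint J7: the level hypothesis is explicit). [cite: Balaban1984PropagatorsII, (2.147) p.248, bookkeeping] -/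
theorem tauL_le_rad (hℓ : 4 ≤ ℓ) (i : BondIdx (domT hN D hk)) (hj : 1 ≤ lvl hN D hk i) (u : ℕ) : tauL hN D hk i u ≤ rad hN D hk i := by
  have h := tauL_le_erad hN D hk i u
  rw [erad_eq_rad hN D hk hℓ i hj] at h
  exact h

/-- `τ(L^j − 1) = 0` at levels `j ≥ 1` (the tent vanishes on the last slice in both cases; LEVEL-0 TWIN, joint J7: the level hypothesis is
explicit — for a level-0 index bond the last slice is the only one and `τ = 1` there, `tauL_last_le_one`). [cite: Balaban1984PropagatorsII, (2.147) p.248, bookkeeping] -/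
theorem tauL_last (hℓ : 4 ≤ ℓ) (i : BondIdx (domT hN D hk)) (hj : 1 ≤ lvl hN D hk i) : tauL hN D hk i ((ℓ + 1) ^ (lvl hN D hk i) - 1) = 0 := by
  have h5 := five_mul_rad_le hN D hk i
  have hS : 1 ≤ (ℓ + 1) ^ (lvl hN D hk i) := Nat.one_le_pow _ _ (by omega)
  unfold tauL
  rw [erad_eq_rad hN D hk hℓ i hj]
  refine max_eq_left ?_
  rw [sub_nonpos]
  have hc : (ctr hN D hk i : ℝ) + rad hN D hk i ≤ (((ℓ + 1) ^ (lvl hN D hk i) - 1 : ℕ) : ℝ) := by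
    have : ctr hN D hk i + rad hN D hk i ≤ (ℓ + 1) ^ (lvl hN D hk i) - 1 := by unfold ctr; split_ifs <;> omega
    exact_mod_cast this
  rw [le_abs]; left; linarith

/-- `τ(L^j − 1) ≤ 1` at every level (LEVEL-0 TWIN, joint J7). [cite: Balaban1984PropagatorsII, (2.147) p.248, bookkeeping] -/
theorem tauL_last_le_one (i : BondIdx (domT hN D hk)) : tauL hN D hk i ((ℓ + 1) ^ (lvl hN D hk i) - 1) ≤ 1 := by
  have hfit := ctr_fit' hN D hk i
  have hS : 1 ≤ (ℓ + 1) ^ (lvl hN D hk i) := Nat.one_le_pow _ _ (by omega)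
  unfold tauL
  refine max_le zero_le_one ?_
  have hc : (ctr hN D hk i : ℝ) + erad hN D hk i ≤ (((ℓ + 1) ^ (lvl hN D hk i) - 1 : ℕ) : ℝ) + 1 := by
    have : ctr hN D hk i + erad hN D hk i ≤ (ℓ + 1) ^ (lvl hN D hk i) - 1 + 1 := by omega
    exact_mod_cast this
  have := le_abs_self ((((ℓ + 1) ^ (lvl hN D hk i) - 1 : ℕ) : ℝ) - ctr hN D hk i)
  linarith

/-- `τ(0) ≤ 1` (`= 0` in case A, `= 1` in case B). [cite: Balaban1984PropagatorsII, (2.147) p.248, bookkeeping] -/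
theorem tauL_zero_le (i : BondIdx (B6GlobalChartV1L0.domT hN D hk)) : tauL hN D hk i 0 ≤ 1 := by
  have hfit := ctr_fit' hN D hk i
  unfold tauL
  refine max_le zero_le_one ?_
  push_cast
  rw [zero_sub, abs_neg, abs_of_nonneg (Nat.cast_nonneg _)]
  have : (erad hN D hk i : ℝ) ≤ ctr hN D hk i + 1 := by exact_mod_cast hfit.1
  linarith

end Grad

section Grad2

open B5Eq118OneStroke (iterBlock iterBlockOf mem_iterBlock mem_iterBlock_iff)
open B6MultiLevelBoxOperator (N0)
open B6MultiLevelTorusOperatorL0 (TDomains)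
open B6GlobalChartV1 (PV)
open B6GlobalChartV1L0 (domT)
open B6Ineq2142KLevelV1 (cQ)
open B6Ineq2142KLevelV1L0 (lvl lvl_le lvl_le_mK base)

variable {d ℓ m K : ℕ} {hd : 1 ≤ d + 1} {hL : Odd (ℓ + 1) ∧ 1 < ℓ + 1}
variable {Mh k R : ℕ} {P' : Fin (d + 1) → ℕ}
variable (hN : ∀ μ, N0 ℓ Mh k P' μ = (PV d ℓ m K hd hL).sitesPerDir 0) (D : TDomains d ℓ Mh k P' R) (hk : k ≤ m + K)

/-- `Θ(x) = Π_{ν′ ≠ μ} τ_⊥(loc_{ν′} x)²`. [cite: Balaban1984PropagatorsII, (2.147) p.248, bookkeeping ours] -/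
def Theta (i : BondIdx (domT hN D hk)) (x : Site (PV d ℓ m K hd hL) 0) : ℝ :=
  ∏ ν' ∈ Finset.univ.erase i.1.2.dir, tauT (ℓ := ℓ) (lvl hN D hk i) (loc (lvl hN D hk i) x ν') ^ 2

/-- `Θ_ν(x) = Π_{ν′ ∉ {μ, ν}} τ_⊥(loc_{ν′} x)²`. [cite: Balaban1984PropagatorsII, (2.147) p.248, bookkeeping ours] -/
def ThetaT (i : BondIdx (domT hN D hk)) (ν : Fin (d + 1)) (x : Site (PV d ℓ m K hd hL) 0) : ℝ :=
  ∏ ν' ∈ (Finset.univ.erase i.1.2.dir).erase ν, tauT (ℓ := ℓ) (lvl hN D hk i) (loc (lvl hN D hk i) x ν') ^ 2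

/-- the majorant density `A_ν(x)` of `(Δ_νφ_i)²`. [cite: Balaban1984PropagatorsII, (2.147) p.248, bookkeeping ours] -/
def Adens (i : BondIdx (domT hN D hk)) (ν : Fin (d + 1)) (x : Site (PV d ℓ m K hd hL) 0) : ℝ :=
  if x ∈ iterBlock (lvl hN D hk i) (base hN D hk i) then
    (if ν = i.1.2.dir then Theta hN D hk i x else tauL hN D hk i (loc (lvl hN D hk i) x i.1.2.dir) ^ 2 * ThetaT hN D hk i ν x)
  else 0

/-- `A_ν ≥ 0`. [cite: Balaban1984PropagatorsII, (2.147) p.248, bookkeeping] -/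
theorem Adens_nonneg (i : BondIdx (domT hN D hk)) (ν : Fin (d + 1)) (x : Site (PV d ℓ m K hd hL) 0) : 0 ≤ Adens hN D hk i ν x := by
  unfold Adens Theta ThetaT
  split_ifs
  · exact Finset.prod_nonneg fun _ _ => sq_nonneg _
  · exact mul_nonneg (sq_nonneg _) (Finset.prod_nonneg fun _ _ => sq_nonneg _)
  · exact le_rfl

/-- the bump off its support. [cite: Balaban1984PropagatorsII, (2.147) p.248, bookkeeping] -/
theorem bump_eq_zero_of_not_mem (i : BondIdx (B6GlobalChartV1L0.domT hN D hk)) {x : Site (PV d ℓ m K hd hL) 0}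
    (hx : x ∉ iterBlock (lvl hN D hk i) (base hN D hk i)) (ν' : Fin (d + 1)) : bump hN D hk i ⟨x, ν'⟩ = 0 := by
  show bumpFn hN D hk i ⟨x, ν'⟩ = 0
  unfold bumpFn; rw [if_neg (fun h => hx h.2)]

/-- the bump on its support. [cite: Balaban1984PropagatorsII, (2.147) p.248, bookkeeping] -/
theorem bump_eq_of_mem (i : BondIdx (B6GlobalChartV1L0.domT hN D hk)) {x : Site (PV d ℓ m K hd hL) 0} (hx : x ∈ iterBlock (lvl hN D hk i) (base hN D hk i)) :
    bump hN D hk i ⟨x, i.1.2.dir⟩ = tauL hN D hk i (loc (lvl hN D hk i) x i.1.2.dir) *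
      ∏ ν' ∈ Finset.univ.erase i.1.2.dir, tauT (ℓ := ℓ) (lvl hN D hk i) (loc (lvl hN D hk i) x ν') := by
  show bumpFn hN D hk i ⟨x, i.1.2.dir⟩ = _
  unfold bumpFn; rw [if_pos ⟨rfl, hx⟩]

/-- **THE PER-BOND GRADIENT BOUND**: `(Δ_νφ_i)(f)² ≤ A_ν(f₋) + A_ν(f₋ + e_ν)` for `μ_i`-bonds, `= 0` for the others.
[cite: Balaban1984PropagatorsII, (2.147) p.248, bookkeeping] -/
theorem bdiff_sq_le (i : BondIdx (domT hN D hk)) (hper : 2 ≤ (PV d ℓ m K hd hL).sitesPerDir (lvl hN D hk i))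
    (x : Site (PV d ℓ m K hd hL) 0) (ν' ν : Fin (d + 1)) :
    bdiff (bump hN D hk i) ν ⟨x, ν'⟩ ^ 2 ≤ if ν' = i.1.2.dir then Adens hN D hk i ν x + Adens hN D hk i ν (x.shift ν) else 0 := by
  classical
  set j := lvl hN D hk i
  set μ := i.1.2.dir
  set B := iterBlock j (base hN D hk i) with hBdef
  have hjm : j ≤ m + K := lvl_le_mK hN D hk i
  by_cases hd' : ν' = μ
  swap
  · rw [if_neg hd']
    have h0 : bdiff (bump hN D hk i) ν ⟨x, ν'⟩ = 0 := by
      unfold bdiff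
      have h1 : bump hN D hk i ⟨x.shift ν, ν'⟩ = 0 := by
        show bumpFn hN D hk i _ = 0; unfold bumpFn; rw [if_neg (fun h => hd' h.1)]
      have h2 : bump hN D hk i ⟨x, ν'⟩ = 0 := by
        show bumpFn hN D hk i _ = 0; unfold bumpFn; rw [if_neg (fun h => hd' h.1)]
      rw [h1, h2, sub_zero]
    rw [h0]; simp
  subst hd'
  rw [if_pos rfl]
  have hA0 := Adens_nonneg hN D hk i ν x
  have hA1 := Adens_nonneg hN D hk i ν (x.shift ν)
  unfold bdiff
  by_cases hx : x ∈ B <;> by_cases hx' : x.shift ν ∈ B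
  · -- inside → inside
    have hsm := shift_mem_iff hjm hper hx ν
    have hlt : loc j x ν + 1 < (ℓ + 1) ^ j := hsm.1.1 hx'
    obtain ⟨hlν, hloth⟩ := hsm.2 hlt
    rw [bump_eq_of_mem hN D hk i hx, bump_eq_of_mem hN D hk i hx']
    by_cases hν : ν = i.1.2.dir
    · -- longitudinal step: only `τ` changes
      have hprod : ∏ ν' ∈ Finset.univ.erase i.1.2.dir, tauT (ℓ := ℓ) j (loc j (x.shift ν) ν') =
          ∏ ν' ∈ Finset.univ.erase i.1.2.dir, tauT (ℓ := ℓ) j (loc j x ν') :=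
        Finset.prod_congr rfl fun ν' hν' => by rw [hloth ν' (by rw [hν] at *; exact Finset.ne_of_mem_erase hν')]
      rw [hprod, ← sub_mul, mul_pow]
      have hstep : (tauL hN D hk i (loc j (x.shift ν) i.1.2.dir) - tauL hN D hk i (loc j x i.1.2.dir)) ^ 2 ≤ 1 := by
        rw [← hν, hlν]
        have h := tauL_step hN D hk i (loc j x ν)
        rw [abs_le] at h
        nlinarith [h.1, h.2]
      have hT : (∏ ν' ∈ Finset.univ.erase i.1.2.dir, tauT (ℓ := ℓ) j (loc j x ν')) ^ 2 = Theta hN D hk i x := by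
        unfold Theta; rw [← Finset.prod_pow]
      calc _ ≤ 1 * (∏ ν' ∈ Finset.univ.erase i.1.2.dir, tauT (ℓ := ℓ) j (loc j x ν')) ^ 2 := mul_le_mul_of_nonneg_right hstep (sq_nonneg _)
        _ = Adens hN D hk i ν x := by rw [one_mul, hT]; unfold Adens; rw [if_pos hx, if_pos hν]
        _ ≤ _ := le_add_of_nonneg_right hA1
    · -- transverse step: only `τ_⊥` in direction `ν` changes
      have hνmem : ν ∈ Finset.univ.erase i.1.2.dir := Finset.mem_erase.2 ⟨hν, Finset.mem_univ _⟩
      have hlμ : loc j (x.shift ν) i.1.2.dir = loc j x i.1.2.dir := hloth _ (fun h => hν h.symm)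
      rw [hlμ, ← Finset.mul_prod_erase _ _ hνmem, ← Finset.mul_prod_erase (Finset.univ.erase i.1.2.dir) (fun ν' => tauT (ℓ := ℓ) j (loc j x ν')) hνmem]
      have hrest : ∏ ν' ∈ (Finset.univ.erase i.1.2.dir).erase ν, tauT (ℓ := ℓ) j (loc j (x.shift ν) ν') =
          ∏ ν' ∈ (Finset.univ.erase i.1.2.dir).erase ν, tauT (ℓ := ℓ) j (loc j x ν') :=
        Finset.prod_congr rfl fun ν' hν' => by rw [hloth ν' (Finset.ne_of_mem_erase hν')]
      rw [hrest, hlν]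
      set Q := ∏ ν' ∈ (Finset.univ.erase i.1.2.dir).erase ν, tauT (ℓ := ℓ) j (loc j x ν')
      set τv := tauL hN D hk i (loc j x i.1.2.dir)
      have hstep : (tauT (ℓ := ℓ) j (loc j x ν + 1) - tauT (ℓ := ℓ) j (loc j x ν)) ^ 2 ≤ 1 := by
        have h := tauT_step (ℓ := ℓ) j (loc j x ν)
        rw [abs_le] at h
        nlinarith [h.1, h.2]
      have hQ : Q ^ 2 = ThetaT hN D hk i ν x := by unfold ThetaT; rw [← Finset.prod_pow]
      calc (τv * (tauT (ℓ := ℓ) j (loc j x ν + 1) * Q) - τv * (tauT (ℓ := ℓ) j (loc j x ν) * Q)) ^ 2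
          = τv ^ 2 * (tauT (ℓ := ℓ) j (loc j x ν + 1) - tauT (ℓ := ℓ) j (loc j x ν)) ^ 2 * Q ^ 2 := by ring
        _ ≤ τv ^ 2 * 1 * Q ^ 2 := by
            refine mul_le_mul_of_nonneg_right (mul_le_mul_of_nonneg_left hstep (sq_nonneg _)) (sq_nonneg _)
        _ = Adens hN D hk i ν x := by rw [mul_one, hQ]; unfold Adens; rw [if_pos hx, if_neg hν]
        _ ≤ _ := le_add_of_nonneg_right hA1
  · -- inside → outside: the boundary slice
    have hsm := shift_mem_iff hjm hper hx ν
    have hlast : loc j x ν = (ℓ + 1) ^ j - 1 := by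
      have h1 := loc_lt j x ν
      have h2 : ¬ (loc j x ν + 1 < (ℓ + 1) ^ j) := fun h => hx' (hsm.1.2 h)
      omega
    rw [bump_eq_zero_of_not_mem hN D hk i hx', zero_sub, neg_sq, bump_eq_of_mem hN D hk i hx]
    by_cases hν : ν = i.1.2.dir
    · -- LEVEL-0 TWIN (joint J7): `τ(L^j − 1) ≤ 1` at every level (it is `0` at levels `≥ 1`, `1` for the level-0 indicator)
      rw [mul_pow]
      have hT : (∏ ν' ∈ Finset.univ.erase i.1.2.dir, tauT (ℓ := ℓ) j (loc j x ν')) ^ 2 = Theta hN D hk i x := by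
        unfold Theta; rw [← Finset.prod_pow]
      have hτ : tauL hN D hk i (loc j x i.1.2.dir) ^ 2 ≤ 1 := by
        rw [← hν, hlast]
        have h1 : tauL hN D hk i ((ℓ + 1) ^ j - 1) ≤ 1 := tauL_last_le_one hN D hk i
        have h0 : 0 ≤ tauL hN D hk i ((ℓ + 1) ^ j - 1) := tauL_nonneg hN D hk i _
        nlinarith
      calc _ ≤ 1 * (∏ ν' ∈ Finset.univ.erase i.1.2.dir, tauT (ℓ := ℓ) j (loc j x ν')) ^ 2 := mul_le_mul_of_nonneg_right hτ (sq_nonneg _)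
        _ = Adens hN D hk i ν x := by rw [one_mul, hT]; unfold Adens; rw [if_pos hx, if_pos hν]
        _ ≤ _ := le_add_of_nonneg_right hA1
    · have hνmem : ν ∈ Finset.univ.erase i.1.2.dir := Finset.mem_erase.2 ⟨hν, Finset.mem_univ _⟩
      rw [← Finset.mul_prod_erase _ _ hνmem, hlast, (tauT_facts (ℓ := ℓ) j 0).2.1, one_mul, mul_pow]
      have hQ : (∏ ν' ∈ (Finset.univ.erase i.1.2.dir).erase ν, tauT (ℓ := ℓ) j (loc j x ν')) ^ 2 = ThetaT hN D hk i ν x := by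
        unfold ThetaT; rw [← Finset.prod_pow]
      rw [hQ]
      calc _ = Adens hN D hk i ν x := by unfold Adens; rw [if_pos hx, if_neg hν]
        _ ≤ _ := le_add_of_nonneg_right hA1
  · -- outside → inside: entering slice
    have hl0 : loc j (x.shift ν) ν = 0 := loc_eq_zero_of_enter hjm hx ν hx'
    rw [bump_eq_zero_of_not_mem hN D hk i hx, sub_zero, bump_eq_of_mem hN D hk i hx']
    by_cases hν : ν = i.1.2.dir
    · rw [mul_pow]
      have hT : (∏ ν' ∈ Finset.univ.erase i.1.2.dir, tauT (ℓ := ℓ) j (loc j (x.shift ν) ν')) ^ 2 = Theta hN D hk i (x.shift ν) := by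
        unfold Theta; rw [← Finset.prod_pow]
      have hτ : tauL hN D hk i (loc j (x.shift ν) i.1.2.dir) ^ 2 ≤ 1 := by
        rw [← hν, hl0]
        have h1 := tauL_zero_le hN D hk i
        have h0 := tauL_nonneg hN D hk i 0
        nlinarith
      calc _ ≤ 1 * (∏ ν' ∈ Finset.univ.erase i.1.2.dir, tauT (ℓ := ℓ) j (loc j (x.shift ν) ν')) ^ 2 := mul_le_mul_of_nonneg_right hτ (sq_nonneg _)
        _ = Adens hN D hk i ν (x.shift ν) := by rw [one_mul, hT]; unfold Adens; rw [if_pos hx', if_pos hν]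
        _ ≤ _ := le_add_of_nonneg_left hA0
    · have hνmem : ν ∈ Finset.univ.erase i.1.2.dir := Finset.mem_erase.2 ⟨hν, Finset.mem_univ _⟩
      rw [← Finset.mul_prod_erase _ _ hνmem, hl0, (tauT_facts (ℓ := ℓ) j 0).1, one_mul, mul_pow]
      have hQ : (∏ ν' ∈ (Finset.univ.erase i.1.2.dir).erase ν, tauT (ℓ := ℓ) j (loc j (x.shift ν) ν')) ^ 2 = ThetaT hN D hk i ν (x.shift ν) := by
        unfold ThetaT; rw [← Finset.prod_pow]
      rw [hQ]
      calc _ = Adens hN D hk i ν (x.shift ν) := by unfold Adens; rw [if_pos hx', if_neg hν]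
        _ ≤ _ := le_add_of_nonneg_left hA0
  · rw [bump_eq_zero_of_not_mem hN D hk i hx, bump_eq_zero_of_not_mem hN D hk i hx', sub_zero]
    simpa using add_nonneg hA0 hA1

end Grad2

section Grad3

open B5Eq118OneStroke (iterBlock iterBlockOf mem_iterBlock mem_iterBlock_iff)
open B6MultiLevelBoxOperator (N0)
open B6MultiLevelTorusOperatorL0 (TDomains)
open B6GlobalChartV1 (PV)
open B6GlobalChartV1L0 (domT)
open B6Ineq2142KLevelV1 (cQ)
open B6Ineq2142KLevelV1L0 (lvl lvl_le lvl_le_mK base)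

variable {d ℓ m K : ℕ} {hd : 1 ≤ d + 1} {hL : Odd (ℓ + 1) ∧ 1 < ℓ + 1}
variable {Mh k R : ℕ} {P' : Fin (d + 1) → ℕ}
variable (hN : ∀ μ, N0 ℓ Mh k P' μ = (PV d ℓ m K hd hL).sitesPerDir 0) (D : TDomains d ℓ Mh k P' R) (hk : k ≤ m + K)

/-- `Σ_u τ(u)²`. [cite: Balaban1984PropagatorsII, (2.147) p.248, bookkeeping] -/
def tt2 (i : BondIdx (domT hN D hk)) : ℝ := ∑ t : Fin ((ℓ + 1) ^ (lvl hN D hk i)), tauL hN D hk i t ^ 2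

/-- **THE LONGITUDINAL DENSITY SUMS TO `L^j·(Στ_⊥²)^d`.** [cite: Balaban1984PropagatorsII, (2.147) p.248, bookkeeping] -/
theorem sum_Adens_long (i : BondIdx (domT hN D hk)) :
    ∑ x ∈ iterBlock (lvl hN D hk i) (base hN D hk i), Adens hN D hk i i.1.2.dir x =
      (((ℓ + 1) ^ (lvl hN D hk i) : ℕ) : ℝ) * TT2 (ℓ := ℓ) (lvl hN D hk i) ^ d := by
  classical
  set j := lvl hN D hk i
  set μ := i.1.2.dir
  set g : Fin (d + 1) → ℕ → ℝ := fun ν u => if ν = μ then 1 else tauT (ℓ := ℓ) j u ^ 2 with hg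
  have h1 : ∀ x ∈ iterBlock j (base hN D hk i), Adens hN D hk i μ x = ∏ ν, g ν (loc j x ν) := by
    intro x hx
    unfold Adens Theta
    rw [if_pos hx, if_pos rfl, ← Finset.mul_prod_erase Finset.univ (fun ν => g ν (loc j x ν)) (Finset.mem_univ μ)]
    simp only [hg, if_true, one_mul]
    exact Finset.prod_congr rfl fun ν hν => by rw [if_neg (Finset.ne_of_mem_erase hν)]
  rw [Finset.sum_congr rfl h1, sum_block_prod (lvl_le_mK hN D hk i),
    ← Finset.mul_prod_erase Finset.univ (fun ν => ∑ t : Fin ((ℓ + 1) ^ j), g ν t) (Finset.mem_univ μ)]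
  simp only [hg, if_true, Finset.sum_const, Finset.card_univ, Fintype.card_fin, nsmul_eq_mul, mul_one]
  rw [Finset.prod_congr rfl fun ν hν => by rw [show (∑ t : Fin ((ℓ + 1) ^ j), if ν = μ then (1 : ℝ) else tauT (ℓ := ℓ) j t ^ 2) =
      TT2 (ℓ := ℓ) j from Finset.sum_congr rfl fun t _ => by rw [if_neg (Finset.ne_of_mem_erase hν)]],
    Finset.prod_const, Finset.card_erase_of_mem (Finset.mem_univ μ), Finset.card_univ, Fintype.card_fin]
  rfl

/-- **A TRANSVERSE DENSITY SUMS TO `Στ²·L^j·(Στ_⊥²)^{d−1}`.** [cite: Balaban1984PropagatorsII, (2.147) p.248, bookkeeping] -/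
theorem sum_Adens_trans (i : BondIdx (domT hN D hk)) {ν : Fin (d + 1)} (hν : ν ≠ i.1.2.dir) :
    ∑ x ∈ iterBlock (lvl hN D hk i) (base hN D hk i), Adens hN D hk i ν x =
      tt2 hN D hk i * (((ℓ + 1) ^ (lvl hN D hk i) : ℕ) : ℝ) * TT2 (ℓ := ℓ) (lvl hN D hk i) ^ (d - 1) := by
  classical
  set j := lvl hN D hk i
  set μ := i.1.2.dir
  set g : Fin (d + 1) → ℕ → ℝ := fun ν' u => if ν' = μ then tauL hN D hk i u ^ 2 else if ν' = ν then 1 else tauT (ℓ := ℓ) j u ^ 2 with hg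
  have hνmem : ν ∈ Finset.univ.erase μ := Finset.mem_erase.2 ⟨hν, Finset.mem_univ _⟩
  have h1 : ∀ x ∈ iterBlock j (base hN D hk i), Adens hN D hk i ν x = ∏ ν', g ν' (loc j x ν') := by
    intro x hx
    unfold Adens ThetaT
    rw [if_pos hx, if_neg hν, ← Finset.mul_prod_erase Finset.univ (fun ν' => g ν' (loc j x ν')) (Finset.mem_univ μ),
      ← Finset.mul_prod_erase (Finset.univ.erase μ) (fun ν' => g ν' (loc j x ν')) hνmem]
    simp only [hg, if_true, if_neg hν, one_mul]
    congr 1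
    exact Finset.prod_congr rfl fun ν' hν' => by
      rw [if_neg (Finset.ne_of_mem_erase (Finset.mem_of_mem_erase hν')), if_neg (Finset.ne_of_mem_erase hν')]
  rw [Finset.sum_congr rfl h1, sum_block_prod (lvl_le_mK hN D hk i),
    ← Finset.mul_prod_erase Finset.univ (fun ν' => ∑ t : Fin ((ℓ + 1) ^ j), g ν' t) (Finset.mem_univ μ),
    ← Finset.mul_prod_erase (Finset.univ.erase μ) (fun ν' => ∑ t : Fin ((ℓ + 1) ^ j), g ν' t) hνmem]
  simp only [hg, if_true, if_neg hν, Finset.sum_const, Finset.card_univ, Fintype.card_fin, nsmul_eq_mul, mul_one]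
  rw [Finset.prod_congr rfl fun ν' hν' => by rw [show (∑ t : Fin ((ℓ + 1) ^ j), if ν' = μ then tauL hN D hk i t ^ 2 else
      if ν' = ν then (1 : ℝ) else tauT (ℓ := ℓ) j t ^ 2) = TT2 (ℓ := ℓ) j from Finset.sum_congr rfl fun t _ => by
        rw [if_neg (Finset.ne_of_mem_erase (Finset.mem_of_mem_erase hν')), if_neg (Finset.ne_of_mem_erase hν')]],
    Finset.prod_const, Finset.card_erase_of_mem hνmem, Finset.card_erase_of_mem (Finset.mem_univ μ), Finset.card_univ, Fintype.card_fin]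
  unfold tt2
  simp only [Nat.add_sub_cancel]
  ring

/-- **THE GRADIENT ENERGY OF ONE BUMP**: `Σ_fΣ_ν (Δ_νφ_i)(f)² ≤ 2·(L^j·(Στ_⊥²)^d + d·Στ²·L^j·(Στ_⊥²)^{d−1})`.
[cite: Balaban1984PropagatorsII, (2.147) p.248, bookkeeping] -/
theorem grad_bump_le (i : BondIdx (domT hN D hk)) (hper : 2 ≤ (PV d ℓ m K hd hL).sitesPerDir (lvl hN D hk i)) :
    ∑ f : PBond (PV d ℓ m K hd hL) 0, ∑ ν : Fin (d + 1), bdiff (bump hN D hk i) ν f ^ 2 ≤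
      2 * ((((ℓ + 1) ^ (lvl hN D hk i) : ℕ) : ℝ) * TT2 (ℓ := ℓ) (lvl hN D hk i) ^ d +
        d * (tt2 hN D hk i * (((ℓ + 1) ^ (lvl hN D hk i) : ℕ) : ℝ) * TT2 (ℓ := ℓ) (lvl hN D hk i) ^ (d - 1))) := by
  classical
  set j := lvl hN D hk i
  set μ := i.1.2.dir
  set B := iterBlock j (base hN D hk i)
  -- per bond
  have h1 : ∑ f : PBond (PV d ℓ m K hd hL) 0, ∑ ν : Fin (d + 1), bdiff (bump hN D hk i) ν f ^ 2 ≤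
      ∑ x : Site (PV d ℓ m K hd hL) 0, ∑ ν : Fin (d + 1), (Adens hN D hk i ν x + Adens hN D hk i ν (x.shift ν)) := by
    rw [B10StarCount.sum_pbond]
    refine Finset.sum_le_sum fun x _ => ?_
    calc ∑ ν' : Fin (d + 1), ∑ ν : Fin (d + 1), bdiff (bump hN D hk i) ν ⟨x, ν'⟩ ^ 2
        ≤ ∑ ν' : Fin (d + 1), ∑ ν : Fin (d + 1), (if ν' = μ then Adens hN D hk i ν x + Adens hN D hk i ν (x.shift ν) else 0) :=
          Finset.sum_le_sum fun ν' _ => Finset.sum_le_sum fun ν _ => bdiff_sq_le hN D hk i hper x ν' ν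
      _ = ∑ ν : Fin (d + 1), (Adens hN D hk i ν x + Adens hN D hk i ν (x.shift ν)) := by
          rw [Finset.sum_comm]
          refine Finset.sum_congr rfl fun ν _ => ?_
          rw [Finset.sum_ite_eq' Finset.univ μ, if_pos (Finset.mem_univ _)]
  refine h1.trans ?_
  -- the shifted copy equals the unshifted one
  rw [Finset.sum_comm]
  have h2 : ∀ ν : Fin (d + 1), ∑ x : Site (PV d ℓ m K hd hL) 0, (Adens hN D hk i ν x + Adens hN D hk i ν (x.shift ν)) =
      2 * ∑ x ∈ B, Adens hN D hk i ν x := by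
    intro ν
    rw [Finset.sum_add_distrib]
    have hsh : ∑ x : Site (PV d ℓ m K hd hL) 0, Adens hN D hk i ν (x.shift ν) = ∑ x : Site (PV d ℓ m K hd hL) 0, Adens hN D hk i ν x :=
      Fintype.sum_equiv ⟨fun x => x.shift ν, fun x => x.unshift ν, fun x => B10StarCount.unshift_shift x ν, fun x => B10StarCount.shift_unshift x ν⟩ _ _ fun x => rfl
    have hB : ∑ x : Site (PV d ℓ m K hd hL) 0, Adens hN D hk i ν x = ∑ x ∈ B, Adens hN D hk i ν x := by
      rw [← Finset.sum_subset (Finset.subset_univ B)]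
      intro x _ hx
      unfold Adens; rw [if_neg hx]
    rw [hsh, hB]; ring
  rw [Finset.sum_congr rfl fun ν _ => h2 ν, ← Finset.mul_sum]
  refine mul_le_mul_of_nonneg_left (le_of_eq ?_) (by norm_num)
  rw [← Finset.add_sum_erase Finset.univ _ (Finset.mem_univ μ), sum_Adens_long hN D hk i]
  congr 1
  rw [Finset.sum_congr rfl fun ν hν => sum_Adens_trans hN D hk i (Finset.ne_of_mem_erase hν), Finset.sum_const,
    Finset.card_erase_of_mem (Finset.mem_univ μ), Finset.card_univ, Fintype.card_fin, nsmul_eq_mul]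
  simp only [Nat.add_sub_cancel]
  rfl

end Grad3

/-! ## §6f  Numeric bounds for the tent sums -/

section Numeric

open B5Eq118OneStroke (iterBlock iterBlockOf mem_iterBlock)
open B6MultiLevelBoxOperator (N0)
open B6MultiLevelTorusOperatorL0 (TDomains)
open B6GlobalChartV1 (PV)
open B6GlobalChartV1L0 (domT)
open B6Ineq2142KLevelV1 (cQ cQ_pos)
open B6Ineq2142KLevelV1L0 (lvl lvl_le lvl_le_mK base)

variable {d ℓ m K : ℕ} {hd : 1 ≤ d + 1} {hL : Odd (ℓ + 1) ∧ 1 < ℓ + 1}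
variable {Mh k R : ℕ} {P' : Fin (d + 1) → ℕ}
variable (hN : ∀ μ, N0 ℓ Mh k P' μ = (PV d ℓ m K hd hL).sitesPerDir 0) (D : TDomains d ℓ Mh k P' R) (hk : k ≤ m + K)

/-- `Στ² ≤ S·r̂²` (LEVEL-0 TWIN: the effective radius). [cite: Balaban1984PropagatorsII, (2.147) p.248, bookkeeping] -/
theorem tt2_le_erad (i : BondIdx (domT hN D hk)) : tt2 hN D hk i ≤ (((ℓ + 1) ^ (lvl hN D hk i) : ℕ) : ℝ) * (erad hN D hk i : ℝ) ^ 2 := by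
  unfold tt2
  have h : ∀ t : Fin ((ℓ + 1) ^ (lvl hN D hk i)), tauL hN D hk i t ^ 2 ≤ (erad hN D hk i : ℝ) ^ 2 := fun t =>
    pow_le_pow_left₀ (tauL_nonneg hN D hk i t) (tauL_le_erad hN D hk i t) 2
  refine (Finset.sum_le_sum fun t _ => h t).trans ?_
  rw [Finset.sum_const, Finset.card_univ, Fintype.card_fin, nsmul_eq_mul]

/-- `Στ² ≤ S·r²` at levels `j ≥ 1` (LEVEL-0 TWIN, joint J7: the level hypothesis is explicit). [cite: Balaban1984PropagatorsII, (2.147) p.248, bookkeeping] -/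
theorem tt2_le (hℓ : 4 ≤ ℓ) (i : BondIdx (domT hN D hk)) (hj : 1 ≤ lvl hN D hk i) :
    tt2 hN D hk i ≤ (((ℓ + 1) ^ (lvl hN D hk i) : ℕ) : ℝ) * (rad hN D hk i : ℝ) ^ 2 := by
  have h := tt2_le_erad hN D hk i
  rw [erad_eq_rad hN D hk hℓ i hj] at h
  exact h

/-- **`Στ ≥ r̂²/2`** (on the window `|u − ctr| ≤ ⌊r̂/2⌋` the tent is `≥ r̂ − ⌊r̂/2⌋ ≥ r̂/2`, and the window has `2⌊r̂/2⌋ + 1 ≥ r̂` points;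
LEVEL-0 TWIN: the effective radius). [cite: Balaban1984PropagatorsII, (2.147) p.248, bookkeeping] -/
theorem tsumL_ge_erad (i : BondIdx (domT hN D hk)) : (erad hN D hk i : ℝ) ^ 2 / 2 ≤ tsumL hN D hk i := by
  set r := erad hN D hk i with hrdef
  set c := ctr hN D hk i with hcdef
  set S := (ℓ + 1) ^ (lvl hN D hk i) with hSdef
  set h := r / 2 with hhdef
  have hr := one_le_erad hN D hk i
  have hfit := ctr_fit' hN D hk i
  have hhr : h < r := by omega
  have hwin : Finset.Icc (c - h) (c + h) ⊆ Finset.range S := by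
    intro t ht; rw [Finset.mem_Icc] at ht; rw [Finset.mem_range]; omega
  unfold tsumL
  rw [Fin.sum_univ_eq_sum_range (f := fun t => tauL hN D hk i t)]
  refine le_trans ?_ (Finset.sum_le_sum_of_subset_of_nonneg hwin fun t _ _ => tauL_nonneg hN D hk i t)
  have hval : ∀ t ∈ Finset.Icc (c - h) (c + h), ((r : ℝ) - h) ≤ tauL hN D hk i t := by
    intro t ht
    rw [Finset.mem_Icc] at ht
    unfold tauL
    refine le_trans ?_ (le_max_right _ _)
    have habs : |(t : ℝ) - c| ≤ h := by
      rw [abs_le]; constructor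
      · have : c ≤ t + h := by omega
        have := (Nat.cast_le (α := ℝ)).2 this; push_cast at this; linarith
      · have : t ≤ c + h := ht.2
        have := (Nat.cast_le (α := ℝ)).2 this; push_cast at this; linarith
    rw [← hrdef, ← hcdef]; linarith
  refine le_trans ?_ (Finset.card_nsmul_le_sum _ _ _ hval)
  rw [Nat.card_Icc, nsmul_eq_mul]
  have hcard : ((c + h + 1 - (c - h) : ℕ) : ℝ) = 2 * h + 1 := by
    have : c + h + 1 - (c - h) = 2 * h + 1 := by omega
    rw [this]; push_cast; ring
  rw [hcard]
  -- `(2h+1)(r − h) ≥ r²/2` with `h = ⌊r/2⌋`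
  have h2 : 2 * h ≤ r := by omega
  have h3 : r ≤ 2 * h + 1 := by omega
  have h2' : 2 * (h : ℝ) ≤ r := by exact_mod_cast h2
  have h3' : (r : ℝ) ≤ 2 * h + 1 := by exact_mod_cast h3
  nlinarith

/-- **`Στ ≥ r²/2`** (LEVEL-0 TWIN: through `r̂ ≥ r`; unconditional). [cite: Balaban1984PropagatorsII, (2.147) p.248, bookkeeping] -/
theorem tsumL_ge (i : BondIdx (domT hN D hk)) : (rad hN D hk i : ℝ) ^ 2 / 2 ≤ tsumL hN D hk i := by
  have h := tsumL_ge_erad hN D hk i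
  have hle : (rad hN D hk i : ℝ) ≤ erad hN D hk i := by exact_mod_cast rad_le_erad hN D hk i
  have h0 : (0 : ℝ) ≤ rad hN D hk i := Nat.cast_nonneg _
  nlinarith

end Numeric

/-! ## §6g  Homogeneity: `W_i·E_i ≤ C·m_i²` for the gradient part and the `Q`-part -/

section Homog

open B5Eq118OneStroke (iterBlock iterBlockOf mem_iterBlock)
open B6MultiLevelBoxOperator (N0)
open B6MultiLevelTorusOperatorL0 (TDomains)
open B6GlobalChartV1 (PV)
open B6GlobalChartV1L0 (domT)
open B6Prop27KLevelV1L0 (wt wt_pos)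
open B6Ineq2142KLevelV1 (cQ cQ_pos)
open B6Ineq2142KLevelV1L0 (lvl lvl_le lvl_le_mK base)

variable {d ℓ m K : ℕ} {hd : 1 ≤ d + 1} {hL : Odd (ℓ + 1) ∧ 1 < ℓ + 1}
variable {Mh k R : ℕ} {P' : Fin (d + 1) → ℕ}
variable (hN : ∀ μ, N0 ℓ Mh k P' μ = (PV d ℓ m K hd hL).sitesPerDir 0) (D : TDomains d ℓ Mh k P' R) (hk : k ≤ m + K)

/-- `L^j ≤ 10r` (`r = ⌊L^j/5⌋ ≥ 1`). [cite: Balaban1984PropagatorsII, (2.147) p.248, bookkeeping] -/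
theorem pow_le_ten_mul_rad (hℓ : 4 ≤ ℓ) (i : BondIdx (domT hN D hk)) (hj : 1 ≤ lvl hN D hk i) :
    (ℓ + 1) ^ (lvl hN D hk i) ≤ 10 * rad hN D hk i := by
  have hr := one_le_rad hN D hk hℓ i hj
  have h : (ℓ + 1) ^ (lvl hN D hk i) < 5 * rad hN D hk i + 5 := by unfold rad; omega
  omega

/-- **THE MASS IN PRODUCT FORM**: `m_i·(L^D)^j·L^j = (L^j − r)·Στ·(Στ_⊥)^d`. [cite: Balaban1984PropagatorsII, (2.147) p.248, bookkeeping] -/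
theorem mass_mul (hℓ : 4 ≤ ℓ) (i : BondIdx (domT hN D hk)) (hper : 2 ≤ (PV d ℓ m K hd hL).sitesPerDir (lvl hN D hk i)) :
    QE (domT hN D hk) (bump hN D hk i) i * (((((ℓ + 1 : ℕ) : ℝ)) ^ (d + 1)) ^ (lvl hN D hk i) * (((ℓ + 1 : ℕ) : ℝ)) ^ (lvl hN D hk i)) =
      (((((ℓ + 1 : ℕ) : ℝ)) ^ (lvl hN D hk i)) - rad hN D hk i) * (tsumL hN D hk i * Tsum (ℓ := ℓ) (lvl hN D hk i) ^ d) := by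
  rw [mass_eq hN D hk hℓ i hper, Nat.cast_pow]
  unfold cQ
  have ha : ((((ℓ + 1 : ℕ) : ℝ) ^ (d + 1)) ^ (lvl hN D hk i)) ≠ 0 := by positivity
  have hb : ((((ℓ + 1 : ℕ) : ℝ)) ^ (lvl hN D hk i)) ≠ 0 := by positivity
  field_simp

/-- **HOMOGENEITY OF THE `Q`-PART**: `W_i·Σ_{i′}w_{i′}(Qφ_i)_{i′}² ≤ (25/8)·b₁·L^D·m_i²`.
[cite: Balaban1984PropagatorsII, (2.147) p.248, (2.16) p.225, bookkeeping] -/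
theorem qpart_hom (hℓ : 4 ≤ ℓ) (hRM : 2 ≤ R * Mh) (hper : ∀ n, n ≤ k + 1 → 2 ≤ (PV d ℓ m K hd hL).sitesPerDir n)
    {cf b₁ : ℝ} (hcf : cf ≠ 0) (hb₁ : 0 ≤ b₁) {w : BondIdx (domT hN D hk) → ℝ}
    (hwup : ∀ i', w i' ≤ b₁ * cf ^ 2 * (((ℓ + 1 : ℕ) : ℝ) ^ (d + 1)) ^ (lvl hN D hk i') / ((((ℓ + 1 : ℕ) : ℝ)) ^ (lvl hN D hk i')) ^ 2)
    (i : BondIdx (domT hN D hk)) :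
    wt hN D hk cf i * ∑ i', w i' * QE (domT hN D hk) (bump hN D hk i) i' ^ 2 ≤
      (25 / 8 * b₁ * (((ℓ + 1 : ℕ) : ℝ)) ^ (d + 1)) * QE (domT hN D hk) (bump hN D hk i) i ^ 2 := by
  set j := lvl hN D hk i
  set Lr : ℝ := ((ℓ + 1 : ℕ) : ℝ)
  set A : ℝ := (Lr ^ (d + 1)) ^ j with hA
  set Sr : ℝ := Lr ^ j with hSr
  set M : ℝ := tsumL hN D hk i * Tsum (ℓ := ℓ) j ^ d
  set mm : ℝ := QE (domT hN D hk) (bump hN D hk i) i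
  set r : ℝ := (rad hN D hk i : ℝ)
  have hA0 : 0 < A := by positivity
  have hS0 : 0 < Sr := by positivity
  have hq := qenergy_bump_le hN D hk hRM hper hb₁ hwup i
  have hmass := mass_mul hN D hk hℓ i (hper j (by have := lvl_le hN D hk i; omega))
  have h5 : 5 * r ≤ Sr := by
    have h := five_mul_rad_le hN D hk i
    have h' : ((5 * rad hN D hk i : ℕ) : ℝ) ≤ (((ℓ + 1) ^ j : ℕ) : ℝ) := by exact_mod_cast h
    rw [Nat.cast_pow, Nat.cast_mul, show ((5 : ℕ) : ℝ) = 5 by norm_num] at h'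
    exact h'
  have hr0 : 0 ≤ r := Nat.cast_nonneg _
  have hM0 : 0 ≤ M := mul_nonneg (Finset.sum_nonneg fun t _ => tauL_nonneg hN D hk i t) (pow_nonneg (Tsum_pos (ℓ := ℓ) j).le _)
  have hmm0 : 0 ≤ mm := pair_nonneg hN D hk i i
  have hwt : wt hN D hk cf i = Sr ^ 2 / cf ^ 2 * A⁻¹ := by unfold wt; rw [div_pow]
  rw [hwt]
  -- step 3: `A⁻¹M ≤ (5/4)·mm`
  have h1 : mm * (A * Sr) = (Sr - r) * M := hmass
  have hSr : 0 < Sr - r := by linarith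
  have hAM : A⁻¹ * M ≤ 5 / 4 * mm := by
    have e : A⁻¹ * M = mm * Sr / (Sr - r) := by
      field_simp
      linarith [h1]
    rw [e, div_le_iff₀ hSr]
    nlinarith
  have hAM0 : 0 ≤ A⁻¹ * M := mul_nonneg (inv_nonneg.2 hA0.le) hM0
  have hsq : (A⁻¹ * M) ^ 2 ≤ (5 / 4 * mm) ^ 2 := pow_le_pow_left₀ hAM0 hAM 2
  calc Sr ^ 2 / cf ^ 2 * A⁻¹ * ∑ i', w i' * QE (domT hN D hk) (bump hN D hk i) i' ^ 2
      ≤ Sr ^ 2 / cf ^ 2 * A⁻¹ * (2 * b₁ * cf ^ 2 * Lr ^ (d + 1) * (Sr ^ 2)⁻¹ * A⁻¹ * M ^ 2) :=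
        mul_le_mul_of_nonneg_left hq (by positivity)
    _ = 2 * b₁ * Lr ^ (d + 1) * (A⁻¹ * M) ^ 2 := by field_simp
    _ ≤ 2 * b₁ * Lr ^ (d + 1) * (5 / 4 * mm) ^ 2 := mul_le_mul_of_nonneg_left hsq (by positivity)
    _ = (25 / 8 * b₁ * Lr ^ (d + 1)) * mm ^ 2 := by ring

end Homog

section Homog2

open B5Eq118OneStroke (iterBlock iterBlockOf mem_iterBlock)
open B6MultiLevelBoxOperator (N0)
open B6MultiLevelTorusOperatorL0 (TDomains)
open B6GlobalChartV1 (PV)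
open B6GlobalChartV1L0 (domT)
open B6Prop27KLevelV1L0 (wt wt_pos)
open B6Ineq2142KLevelV1 (cQ cQ_pos)
open B6Ineq2142KLevelV1L0 (lvl lvl_le lvl_le_mK base)

variable {d ℓ m K : ℕ} {hd : 1 ≤ d + 1} {hL : Odd (ℓ + 1) ∧ 1 < ℓ + 1}
variable {Mh k R : ℕ} {P' : Fin (d + 1) → ℕ}
variable (hN : ∀ μ, N0 ℓ Mh k P' μ = (PV d ℓ m K hd hL).sitesPerDir 0) (D : TDomains d ℓ Mh k P' R) (hk : k ≤ m + K)

/-- **THE GRADIENT SUM IN MONOMIAL FORM**: `Σ_fΣ_ν(Δ_νφ_i)² ≤ 2(1 + d/25)·L^j·(L^{3j})^d`. [cite: Balaban1984PropagatorsII, (2.147) p.248, bookkeeping] -/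
theorem grad_bump_le' (hℓ : 4 ≤ ℓ) (i : BondIdx (domT hN D hk)) (hj : 1 ≤ lvl hN D hk i) (hper : 2 ≤ (PV d ℓ m K hd hL).sitesPerDir (lvl hN D hk i)) :
    ∑ f : PBond (PV d ℓ m K hd hL) 0, ∑ ν : Fin (d + 1), bdiff (bump hN D hk i) ν f ^ 2 ≤
      2 * (1 + (d : ℝ) / 25) * (((ℓ + 1 : ℕ) : ℝ)) ^ (lvl hN D hk i) * (((((ℓ + 1 : ℕ) : ℝ)) ^ (lvl hN D hk i)) ^ 3) ^ d := by
  set j := lvl hN D hk i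
  set Sr : ℝ := (((ℓ + 1 : ℕ) : ℝ)) ^ j with hSr
  set r : ℝ := (rad hN D hk i : ℝ)
  have hS1 : 1 ≤ Sr := one_le_pow₀ (by exact_mod_cast Nat.succ_le_succ (Nat.zero_le ℓ))
  have hS0 : 0 < Sr := lt_of_lt_of_le zero_lt_one hS1
  have hcast : ((((ℓ + 1) ^ j : ℕ)) : ℝ) = Sr := Nat.cast_pow _ _
  have hG := grad_bump_le hN D hk i hper
  rw [hcast] at hG
  have hT2 : TT2 (ℓ := ℓ) j ≤ Sr ^ 3 := by have := TT2_le (ℓ := ℓ) j; rwa [hcast] at this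
  have hT20 : 0 ≤ TT2 (ℓ := ℓ) j := Finset.sum_nonneg fun t _ => sq_nonneg _
  have ht2 : tt2 hN D hk i ≤ Sr * r ^ 2 := by have := tt2_le hN D hk hℓ i hj; rwa [hcast] at this
  have ht20 : 0 ≤ tt2 hN D hk i := Finset.sum_nonneg fun t _ => sq_nonneg _
  have h5 : 5 * r ≤ Sr := by
    have h' : ((5 * rad hN D hk i : ℕ) : ℝ) ≤ (((ℓ + 1) ^ j : ℕ) : ℝ) := by exact_mod_cast five_mul_rad_le hN D hk i
    rw [Nat.cast_pow, Nat.cast_mul, show ((5 : ℕ) : ℝ) = 5 by norm_num] at h'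
    exact h'
  have hr0 : 0 ≤ r := Nat.cast_nonneg _
  -- first term
  have hA : Sr * TT2 (ℓ := ℓ) j ^ d ≤ Sr * (Sr ^ 3) ^ d :=
    mul_le_mul_of_nonneg_left (pow_le_pow_left₀ hT20 hT2 d) hS0.le
  -- second term: `d·tt2·S·TT2^{d−1} ≤ (d/25)·S·(S³)^d`
  have hB : (d : ℝ) * (tt2 hN D hk i * Sr * TT2 (ℓ := ℓ) j ^ (d - 1)) ≤ (d : ℝ) / 25 * (Sr * (Sr ^ 3) ^ d) := by
    rcases Nat.eq_zero_or_pos d with hd0 | hdpos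
    · subst hd0; simp
    · have hr2 : r ^ 2 ≤ Sr ^ 2 / 25 := by nlinarith
      have h1 : tt2 hN D hk i ≤ Sr ^ 3 / 25 := ht2.trans (by nlinarith)
      have h2 : TT2 (ℓ := ℓ) j ^ (d - 1) ≤ (Sr ^ 3) ^ (d - 1) := pow_le_pow_left₀ hT20 hT2 _
      have h3 : tt2 hN D hk i * Sr * TT2 (ℓ := ℓ) j ^ (d - 1) ≤ (Sr ^ 3 / 25) * Sr * (Sr ^ 3) ^ (d - 1) := by
        gcongr
      have h4 : (Sr ^ 3 / 25) * Sr * (Sr ^ 3) ^ (d - 1) = (1 / 25) * (Sr * (Sr ^ 3) ^ d) := by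
        obtain ⟨e, he⟩ := Nat.exists_eq_add_of_le hdpos
        rw [he, Nat.add_sub_cancel_left, pow_succ]; ring
      rw [h4] at h3
      have hd0 : (0 : ℝ) ≤ d := Nat.cast_nonneg _
      calc (d : ℝ) * (tt2 hN D hk i * Sr * TT2 (ℓ := ℓ) j ^ (d - 1)) ≤ (d : ℝ) * ((1 / 25) * (Sr * (Sr ^ 3) ^ d)) :=
            mul_le_mul_of_nonneg_left h3 hd0
        _ = _ := by ring
  calc _ ≤ 2 * (Sr * TT2 (ℓ := ℓ) j ^ d + d * (tt2 hN D hk i * Sr * TT2 (ℓ := ℓ) j ^ (d - 1))) := hG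
    _ ≤ 2 * (Sr * (Sr ^ 3) ^ d + (d : ℝ) / 25 * (Sr * (Sr ^ 3) ^ d)) := by linarith
    _ = _ := by ring

/-- LEVEL-0 TWIN (joint J7): **the gradient part for a level-0 index bond** — there `φ_i` is the indicator of the bond `i` (`r̂ = 1`),
`W_i·c_f² = 1`, `Σ_fΣ_ν(Δ_νφ_i)² ≤ 2(d + 1)` and `m_i ≥ ½·8^{−d}`, so the lineage constant `C_∇(d)` is ample.
[cite: Balaban1984PropagatorsII, (2.147) p.248, (2.20) p.226, bookkeeping] -/
theorem gpart_hom_of_lvl_eq_zero (hℓ : 4 ≤ ℓ) {cf : ℝ} (hcf : cf ≠ 0) (i : BondIdx (domT hN D hk)) (hj0 : lvl hN D hk i = 0)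
    (hper : 2 ≤ (PV d ℓ m K hd hL).sitesPerDir (lvl hN D hk i)) :
    wt hN D hk cf i * (cf ^ 2 * ∑ f : PBond (PV d ℓ m K hd hL) 0, ∑ ν : Fin (d + 1), bdiff (bump hN D hk i) ν f ^ 2) ≤
      Cgrad d * QE (domT hN D hk) (bump hN D hk i) i ^ 2 := by
  -- the data of a level-0 index bond: `L^j = 1`, `r = 0`, `r̂ = 1`
  have hS : (((ℓ + 1) ^ (lvl hN D hk i) : ℕ) : ℝ) = 1 := by rw [hj0, pow_zero, Nat.cast_one]
  have hr : (rad hN D hk i : ℝ) = 0 := by rw [rad_eq_zero_of_lvl hN D hk i hj0, Nat.cast_zero]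
  have he : (erad hN D hk i : ℝ) = 1 := by rw [erad_eq_one_of_lvl hN D hk i hj0, Nat.cast_one]
  -- `W_i·c_f² = 1`
  have hwt : wt hN D hk cf i * cf ^ 2 = 1 := by
    unfold wt; rw [hj0, pow_zero, pow_zero, inv_one, mul_one, div_pow, one_pow, div_mul_cancel₀ _ (pow_ne_zero 2 hcf)]
  -- the gradient sum is at most `2(d + 1)`
  set G := ∑ f : PBond (PV d ℓ m K hd hL) 0, ∑ ν : Fin (d + 1), bdiff (bump hN D hk i) ν f ^ 2 with hGdef
  have hT2 : TT2 (ℓ := ℓ) (lvl hN D hk i) ≤ 1 := by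
    have := TT2_le (ℓ := ℓ) (lvl hN D hk i); rw [hS, one_pow] at this; exact this
  have hT20 : 0 ≤ TT2 (ℓ := ℓ) (lvl hN D hk i) := Finset.sum_nonneg fun t _ => sq_nonneg _
  have ht2 : tt2 hN D hk i ≤ 1 := by
    have := tt2_le_erad hN D hk i; rw [hS, he, one_pow, one_mul] at this; exact this
  have ht20 : 0 ≤ tt2 hN D hk i := Finset.sum_nonneg fun t _ => sq_nonneg _
  have hd0 : (0 : ℝ) ≤ d := Nat.cast_nonneg _
  have hG : G ≤ 2 * (1 + (d : ℝ)) := by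
    have h := grad_bump_le hN D hk i hper
    rw [hS] at h
    have h1 : TT2 (ℓ := ℓ) (lvl hN D hk i) ^ d ≤ 1 := pow_le_one₀ hT20 hT2
    have h2 : TT2 (ℓ := ℓ) (lvl hN D hk i) ^ (d - 1) ≤ 1 := pow_le_one₀ hT20 hT2
    have h3 : tt2 hN D hk i * 1 * TT2 (ℓ := ℓ) (lvl hN D hk i) ^ (d - 1) ≤ 1 := by
      rw [mul_one]
      calc _ ≤ (1 : ℝ) * 1 := mul_le_mul ht2 h2 (pow_nonneg hT20 _) zero_le_one
        _ = 1 := one_mul 1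
    have h4 : (d : ℝ) * (tt2 hN D hk i * 1 * TT2 (ℓ := ℓ) (lvl hN D hk i) ^ (d - 1)) ≤ d * 1 := mul_le_mul_of_nonneg_left h3 hd0
    calc G ≤ 2 * (1 * TT2 (ℓ := ℓ) (lvl hN D hk i) ^ d + d * (tt2 hN D hk i * 1 * TT2 (ℓ := ℓ) (lvl hN D hk i) ^ (d - 1))) := h
      _ ≤ 2 * (1 + (d : ℝ)) := by linarith
  -- the mass is at least `½·8^{−d}`
  have hmass := mass_mul hN D hk hℓ i hper
  simp only [hj0, pow_zero, mul_one, hr, sub_zero, one_mul] at hmass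
  have hts : (1 : ℝ) / 2 ≤ tsumL hN D hk i := by
    have := tsumL_ge_erad hN D hk i; rw [he, one_pow] at this; exact this
  have hTs : (1 : ℝ) / 8 ≤ Tsum (ℓ := ℓ) 0 := by
    have := Tsum_ge (ℓ := ℓ) 0; rw [pow_zero, Nat.cast_one, one_pow] at this; exact this
  have hmm : 1 / 2 * (1 / 8) ^ d ≤ QE (domT hN D hk) (bump hN D hk i) i := by
    rw [hmass]
    exact mul_le_mul hts (pow_le_pow_left₀ (by norm_num) hTs d) (by positivity) (le_trans (by norm_num) hts)
  have hsq : (1 / 2 * (1 / 8) ^ d) ^ 2 ≤ QE (domT hN D hk) (bump hN D hk i) i ^ 2 := pow_le_pow_left₀ (by positivity) hmm 2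
  have h8 : (8 : ℝ) ^ (2 * d) * ((1 / 8) ^ d) ^ 2 = 1 := by
    rw [← pow_mul, mul_comm d 2, ← mul_pow]; norm_num
  have hC : Cgrad d * (1 / 2 * (1 / 8) ^ d) ^ 2 = 31250 * (1 + (d : ℝ) / 25) := by
    unfold Cgrad
    rw [mul_pow]
    calc 2 * (1 + (d : ℝ) / 25) * 8 ^ (2 * d) * 62500 * ((1 / 2) ^ 2 * ((1 / 8) ^ d) ^ 2)
        = 2 * (1 + (d : ℝ) / 25) * 62500 * (1 / 2) ^ 2 * ((8 : ℝ) ^ (2 * d) * ((1 / 8) ^ d) ^ 2) := by ring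
      _ = 31250 * (1 + (d : ℝ) / 25) := by rw [h8]; ring
  calc wt hN D hk cf i * (cf ^ 2 * G) = G := by rw [← mul_assoc, hwt, one_mul]
    _ ≤ 2 * (1 + (d : ℝ)) := hG
    _ ≤ 31250 * (1 + (d : ℝ) / 25) := by linarith
    _ = Cgrad d * (1 / 2 * (1 / 8) ^ d) ^ 2 := hC.symm
    _ ≤ Cgrad d * QE (domT hN D hk) (bump hN D hk i) i ^ 2 := mul_le_mul_of_nonneg_left hsq (by unfold Cgrad; positivity)

/-- **HOMOGENEITY OF THE GRADIENT PART**: `W_i·c_f²·Σ_fΣ_ν(Δ_νφ_i)² ≤ C_∇(d)·m_i²` (LEVEL-0 TWIN: level `0` by `gpart_hom_of_lvl_eq_zero`,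
levels `≥ 1` by the lineage's argument). [cite: Balaban1984PropagatorsII, (2.147) p.248, bookkeeping] -/
theorem gpart_hom (hℓ : 4 ≤ ℓ) {cf : ℝ} (hcf : cf ≠ 0) (i : BondIdx (domT hN D hk))
    (hper : 2 ≤ (PV d ℓ m K hd hL).sitesPerDir (lvl hN D hk i)) :
    wt hN D hk cf i * (cf ^ 2 * ∑ f : PBond (PV d ℓ m K hd hL) 0, ∑ ν : Fin (d + 1), bdiff (bump hN D hk i) ν f ^ 2) ≤
      Cgrad d * QE (domT hN D hk) (bump hN D hk i) i ^ 2 := by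
  rcases Nat.eq_zero_or_pos (lvl hN D hk i) with hj0 | hj
  · exact gpart_hom_of_lvl_eq_zero hN D hk hℓ hcf i hj0 hper
  set j := lvl hN D hk i
  set Lr : ℝ := ((ℓ + 1 : ℕ) : ℝ)
  set A : ℝ := (Lr ^ (d + 1)) ^ j with hA
  set Sr : ℝ := Lr ^ j with hSr
  set M : ℝ := tsumL hN D hk i * Tsum (ℓ := ℓ) j ^ d
  set mm : ℝ := QE (domT hN D hk) (bump hN D hk i) i
  set r : ℝ := (rad hN D hk i : ℝ)
  set G := ∑ f : PBond (PV d ℓ m K hd hL) 0, ∑ ν : Fin (d + 1), bdiff (bump hN D hk i) ν f ^ 2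
  have hA0 : 0 < A := by positivity
  have hS0 : 0 < Sr := by positivity
  have hAS : A = Sr ^ (d + 1) := pow_right_comm _ _ _
  have hG := grad_bump_le' hN D hk hℓ i hj hper
  have hG0 : 0 ≤ G := Finset.sum_nonneg fun f _ => Finset.sum_nonneg fun ν _ => sq_nonneg _
  have hmass : mm * (A * Sr) = (Sr - r) * M := mass_mul hN D hk hℓ i hper
  have h5 : 5 * r ≤ Sr := by
    have h' : ((5 * rad hN D hk i : ℕ) : ℝ) ≤ (((ℓ + 1) ^ j : ℕ) : ℝ) := by exact_mod_cast five_mul_rad_le hN D hk i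
    rw [Nat.cast_pow, Nat.cast_mul, show ((5 : ℕ) : ℝ) = 5 by norm_num] at h'
    exact h'
  have h10 : Sr ≤ 10 * r := by
    have h' : (((ℓ + 1) ^ j : ℕ) : ℝ) ≤ ((10 * rad hN D hk i : ℕ) : ℝ) := by exact_mod_cast pow_le_ten_mul_rad hN D hk hℓ i hj
    rw [Nat.cast_pow, Nat.cast_mul, show ((10 : ℕ) : ℝ) = 10 by norm_num] at h'
    exact h'
  have hr0 : 0 ≤ r := Nat.cast_nonneg _
  -- lower bound for `M` and for `A·mm`
  have htsum : Sr ^ 2 / 200 ≤ tsumL hN D hk i := by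
    have := tsumL_ge hN D hk i
    nlinarith
  have hTsum : Sr ^ 2 / 8 ≤ Tsum (ℓ := ℓ) j := by have := Tsum_ge (ℓ := ℓ) j; rwa [Nat.cast_pow] at this
  have hM : Sr ^ 2 / 200 * (Sr ^ 2 / 8) ^ d ≤ M :=
    mul_le_mul htsum (pow_le_pow_left₀ (by positivity) hTsum d) (by positivity) (le_trans (by positivity) htsum)
  have hM0 : 0 ≤ M := le_trans (by positivity) hM
  have hAm : (1 / 250) * Sr ^ 2 * (Sr ^ 2 / 8) ^ d ≤ A * mm := by
    -- `A·mm·Sr = (Sr − r)M ≥ (4Sr/5)·M`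
    have h1 : (4 / 5 * Sr) * M ≤ A * mm * Sr := by
      have : A * mm * Sr = (Sr - r) * M := by rw [← hmass]; ring
      rw [this]; exact mul_le_mul_of_nonneg_right (by linarith) hM0
    have h2 : (4 / 5 * Sr) * (Sr ^ 2 / 200 * (Sr ^ 2 / 8) ^ d) ≤ (4 / 5 * Sr) * M := mul_le_mul_of_nonneg_left hM (by positivity)
    have h3 : (4 / 5 * Sr) * (Sr ^ 2 / 200 * (Sr ^ 2 / 8) ^ d) = ((1 / 250) * Sr ^ 2 * (Sr ^ 2 / 8) ^ d) * Sr := by ring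
    rw [h3] at h2
    exact le_of_mul_le_mul_right (h2.trans h1) hS0
  have hAm0 : 0 ≤ A * mm := le_trans (by positivity) hAm
  -- `wt·cf² = Sr²/A`
  have hwt : wt hN D hk cf i * cf ^ 2 = Sr ^ 2 * A⁻¹ := by
    unfold wt; rw [div_pow]; field_simp; rw [hA, hSr]; ring
  -- assemble: `Sr²A⁻¹G ≤ Sr²A⁻¹·2κSr(Sr³)^d` and `C·mm² = C(A mm)²A⁻²`
  have step1 : wt hN D hk cf i * (cf ^ 2 * G) ≤ Sr ^ 2 * A⁻¹ * (2 * (1 + (d : ℝ) / 25) * Sr * (Sr ^ 3) ^ d) := by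
    rw [← mul_assoc, hwt]
    exact mul_le_mul_of_nonneg_left hG (by positivity)
  refine step1.trans ?_
  have step2 : Cgrad d * ((1 / 250) * Sr ^ 2 * (Sr ^ 2 / 8) ^ d) ^ 2 ≤ Cgrad d * (A * mm) ^ 2 :=
    mul_le_mul_of_nonneg_left (pow_le_pow_left₀ (by positivity) hAm 2) (by unfold Cgrad; positivity)
  -- `Cgrad·mm² = Cgrad·(A·mm)²·A⁻²`
  have step3 : Cgrad d * mm ^ 2 = Cgrad d * (A * mm) ^ 2 * (A⁻¹) ^ 2 := by field_simp
  rw [step3]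
  refine le_trans ?_ (mul_le_mul_of_nonneg_right step2 (sq_nonneg _))
  -- the monomial identity: both sides equal `2κ·Sr⁴(Sr⁴)^d·A⁻²·Sr^{d+1}`-type expressions
  rw [hAS]
  have hS' : Sr ≠ 0 := hS0.ne'
  have hL' : Lr ≠ 0 := by positivity
  unfold Cgrad
  rw [show (Sr ^ 2 / 8) ^ d = (Sr ^ 2) ^ d / 8 ^ d by rw [div_pow]]
  field_simp
  simp only [hSr]
  apply le_of_eq
  ring

end Homog2

/-! ## §7a  Per-pair bounds for the dominance estimate -/

section Pairs

open B5Eq118OneStroke (iterBlock iterBlockOf mem_iterBlock)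
open B6MultiLevelBoxOperator (N0)
open B6MultiLevelTorusOperatorL0 (TDomains)
open B6GlobalChartV1 (PV)
open B6GlobalChartV1L0 (domT)
open B6Prop27KLevelV1L0 (wt wt_pos)
open B6Ineq2142KLevelV1 (cQ cQ_pos shift_injective)
open B6Ineq2142KLevelV1L0 (lvl lvl_le lvl_le_mK base)

variable {d ℓ m K : ℕ} {hd : 1 ≤ d + 1} {hL : Odd (ℓ + 1) ∧ 1 < ℓ + 1}
variable {Mh k R : ℕ} {P' : Fin (d + 1) → ℕ}
variable (hN : ∀ μ, N0 ℓ Mh k P' μ = (PV d ℓ m K hd hL).sitesPerDir 0) (D : TDomains d ℓ Mh k P' R) (hk : k ≤ m + K)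

/-- **A NONZERO SAME-LEVEL ROW MEETS THE BASE BLOCK BY ONE OF ITS END BLOCKS.** [cite: Balaban1984PropagatorsII, (2.147) p.248, bookkeeping] -/
theorem same_level_block (i i' : BondIdx (B6GlobalChartV1L0.domT hN D hk)) (hj : lvl hN D hk i' = lvl hN D hk i) (h : QE (domT hN D hk) (bump hN D hk i) i' ≠ 0) :
    iterBlock (lvl hN D hk i') i'.1.2.src = iterBlock (lvl hN D hk i) (base hN D hk i) ∨
      iterBlock (lvl hN D hk i') i'.1.2.tgt = iterBlock (lvl hN D hk i) (base hN D hk i) := by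
  obtain ⟨-, z, hz, hends⟩ := witness_of_pair_ne_zero hN D hk i i' h
  rcases hends with h' | h'
  · left; exact iterBlock_eq_of_mem hj h' hz
  · right; exact iterBlock_eq_of_mem hj h' hz

/-- **THE SAME-LEVEL ROWS `≠ i` CARRY AT MOST A QUARTER OF THE MASS**: `Σ_{i′ ≠ i, j(i′) = j(i)} (Qφ_i)_{i′} ≤ m_i/4`.
[cite: Balaban1984PropagatorsII, (2.147) p.248, bookkeeping] -/
theorem same_level_sum_le (hℓ : 4 ≤ ℓ) (i : BondIdx (domT hN D hk)) (hper : 2 ≤ (PV d ℓ m K hd hL).sitesPerDir (lvl hN D hk i)) :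
    ∑ i' ∈ Finset.univ.filter (fun i' : BondIdx (domT hN D hk) => lvl hN D hk i' = lvl hN D hk i ∧ i' ≠ i), QE (domT hN D hk) (bump hN D hk i) i' ≤
      (1 / 4) * QE (domT hN D hk) (bump hN D hk i) i := by
  classical
  have htot := sum_pair_level_le hN D hk i hper
  have hmass := mass_eq hN D hk hℓ i hper
  have hsplit : ∑ i' ∈ Finset.univ.filter (fun i' : BondIdx (domT hN D hk) => lvl hN D hk i' = lvl hN D hk i), QE (domT hN D hk) (bump hN D hk i) i' =
      QE (domT hN D hk) (bump hN D hk i) i +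
        ∑ i' ∈ Finset.univ.filter (fun i' : BondIdx (domT hN D hk) => lvl hN D hk i' = lvl hN D hk i ∧ i' ≠ i), QE (domT hN D hk) (bump hN D hk i) i' := by
    have hmem : i ∈ Finset.univ.filter (fun i' : BondIdx (domT hN D hk) => lvl hN D hk i' = lvl hN D hk i) := by
      rw [Finset.mem_filter]; exact ⟨Finset.mem_univ _, rfl⟩
    rw [← Finset.add_sum_erase _ _ hmem]
    congr 1
    refine Finset.sum_congr ?_ fun _ _ => rfl
    ext i'; simp only [Finset.mem_erase, Finset.mem_filter, Finset.mem_univ, true_and]; tauto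
  rw [hsplit, hmass, Nat.cast_pow] at htot
  rw [hmass, Nat.cast_pow]
  have h5 : 5 * (rad hN D hk i : ℝ) ≤ (((ℓ + 1 : ℕ) : ℝ)) ^ (lvl hN D hk i) := by
    have h' : ((5 * rad hN D hk i : ℕ) : ℝ) ≤ (((ℓ + 1) ^ (lvl hN D hk i) : ℕ) : ℝ) := by exact_mod_cast five_mul_rad_le hN D hk i
    rw [Nat.cast_pow, Nat.cast_mul, show ((5 : ℕ) : ℝ) = 5 by norm_num] at h'
    exact h'
  have hc := cQ_pos (d := d) (ℓ := ℓ) (lvl hN D hk i)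
  have hM : 0 ≤ tsumL hN D hk i * Tsum (ℓ := ℓ) (lvl hN D hk i) ^ d :=
    mul_nonneg (Finset.sum_nonneg fun t _ => tauL_nonneg hN D hk i t) (pow_nonneg (Tsum_pos (ℓ := ℓ) _).le _)
  have key : cQ (d := d) (ℓ := ℓ) (lvl hN D hk i) * (((ℓ + 1 : ℕ) : ℝ)) ^ (lvl hN D hk i) * (tsumL hN D hk i * Tsum (ℓ := ℓ) (lvl hN D hk i) ^ d) ≤
      (5 / 4) * (cQ (d := d) (ℓ := ℓ) (lvl hN D hk i) * ((((ℓ + 1 : ℕ) : ℝ)) ^ (lvl hN D hk i) - rad hN D hk i) * tsumL hN D hk i * Tsum (ℓ := ℓ) (lvl hN D hk i) ^ d) := by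
    have : (((ℓ + 1 : ℕ) : ℝ)) ^ (lvl hN D hk i) ≤ (5 / 4) * ((((ℓ + 1 : ℕ) : ℝ)) ^ (lvl hN D hk i) - rad hN D hk i) := by linarith
    calc _ = (((ℓ + 1 : ℕ) : ℝ)) ^ (lvl hN D hk i) * (cQ (d := d) (ℓ := ℓ) (lvl hN D hk i) * (tsumL hN D hk i * Tsum (ℓ := ℓ) (lvl hN D hk i) ^ d)) := by ring
      _ ≤ (5 / 4) * ((((ℓ + 1 : ℕ) : ℝ)) ^ (lvl hN D hk i) - rad hN D hk i) * (cQ (d := d) (ℓ := ℓ) (lvl hN D hk i) * (tsumL hN D hk i * Tsum (ℓ := ℓ) (lvl hN D hk i) ^ d)) :=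
          mul_le_mul_of_nonneg_right this (mul_nonneg hc.le hM)
      _ = _ := by ring
  linarith

/-- **AT MOST TWO SAME-LEVEL BONDS `i ≠ i′` HAVE A NONZERO ROW `i′`** (their source block is `B(b′₋ − e_μ)` or `B(b′₊)`).
[cite: Balaban1984PropagatorsII, (2.147) p.248, (2.3) p.224, bookkeeping] -/
theorem card_same_level_le (i' : BondIdx (B6GlobalChartV1L0.domT hN D hk)) :
    (Finset.univ.filter fun i : BondIdx (domT hN D hk) => lvl hN D hk i = lvl hN D hk i' ∧ i ≠ i' ∧ QE (domT hN D hk) (bump hN D hk i) i' ≠ 0).card ≤ 2 := by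
  classical
  set j := lvl hN D hk i'
  set μ := i'.1.2.dir
  set K1 := iterBlock j (i'.1.2.src.unshift μ)
  set K2 := iterBlock j i'.1.2.tgt
  have hsub : (Finset.univ.filter fun i : BondIdx (domT hN D hk) => lvl hN D hk i = j ∧ i ≠ i' ∧ QE (domT hN D hk) (bump hN D hk i) i' ≠ 0) ⊆
      (Finset.univ.filter fun i : BondIdx (domT hN D hk) => lvl hN D hk i = j ∧ i.1.2.dir = μ ∧ srcBlk hN D hk i = K1) ∪
      (Finset.univ.filter fun i : BondIdx (domT hN D hk) => lvl hN D hk i = j ∧ i.1.2.dir = μ ∧ srcBlk hN D hk i = K2) := by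
    intro i hi
    rw [Finset.mem_filter] at hi
    obtain ⟨-, hji, hne, hc⟩ := hi
    have hdir : i.1.2.dir = μ := ((witness_of_pair_ne_zero hN D hk i i' hc).1).symm
    have hblk := same_level_block hN D hk i i' hji.symm hc
    rw [Finset.mem_union, Finset.mem_filter, Finset.mem_filter]
    by_cases hA : i.1.2.src ∈ (domT hN D hk).Om (lvl hN D hk i)
    · -- case A: `srcBlk i = B(base i)`; it is `B(b′₊)` (else `i = i′`)
      have hsb : srcBlk hN D hk i = iterBlock (lvl hN D hk i) (base hN D hk i) := by unfold srcBlk; rw [base_eq_src_of hN D hk i hA]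
      rcases hblk with h | h
      · exfalso; exact hne (ext_of_key hN D hk hji hdir (by rw [hsb, ← h]; rfl))
      · right; exact ⟨Finset.mem_univ _, hji, hdir, by rw [hsb, ← h]⟩
    · -- case B: `srcBlk i = B(base i − e_μ)`; `B(base i) = B(b′₋)` (else `i = i′`)
      have hsrc : i.1.2.src = (base hN D hk i).unshift i.1.2.dir := by
        rw [base_eq_tgt_of hN D hk i hA]; exact (tgt_eq_iff_src_eq i.1.2 _).1 rfl
      rcases hblk with h | h
      · left; refine ⟨Finset.mem_univ _, hji, hdir, ?_⟩
        unfold srcBlk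
        rw [hsrc, hdir]
        exact (iterBlock_unshift_eq hji.symm h μ (lvl_le_mK hN D hk i')).symm
      · exfalso
        apply hne
        refine ext_of_key hN D hk hji hdir ?_
        unfold srcBlk
        rw [hsrc, (tgt_eq_iff_src_eq i'.1.2 _).1 rfl, hdir]
        exact (iterBlock_unshift_eq hji.symm h μ (lvl_le_mK hN D hk i')).symm
  refine (Finset.card_le_card hsub).trans ((Finset.card_union_le _ _).trans ?_)
  have h1 := card_key_le_one hN D hk j μ K1
  have h2 := card_key_le_one hN D hk j μ K2
  omega

end Pairs

section Pairs2

open B5Eq118OneStroke (iterBlock iterBlockOf mem_iterBlock)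
open B6MultiLevelBoxOperator (N0)
open B6MultiLevelTorusOperatorL0 (TDomains)
open B6GlobalChartV1 (PV)
open B6GlobalChartV1L0 (domT)
open B6Prop27KLevelV1L0 (wt wt_pos)
open B6Ineq2142KLevelV1 (cQ cQ_pos)
open B6Ineq2142KLevelV1L0 (lvl lvl_le lvl_le_mK base)

variable {d ℓ m K : ℕ} {hd : 1 ≤ d + 1} {hL : Odd (ℓ + 1) ∧ 1 < ℓ + 1}
variable {Mh k R : ℕ} {P' : Fin (d + 1) → ℕ}
variable (hN : ∀ μ, N0 ℓ Mh k P' μ = (PV d ℓ m K hd hL).sitesPerDir 0) (D : TDomains d ℓ Mh k P' R) (hk : k ≤ m + K)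

/-- the mass `m_i = (Qφ_i)_i`. [cite: Balaban1984PropagatorsII, (2.147) p.248, bookkeeping ours] -/
def mass (i : BondIdx (domT hN D hk)) : ℝ := QE (domT hN D hk) (bump hN D hk i) i

/-- the per-bump weight `ν_i = Λ_i²/m_i`. [cite: Balaban1984PropagatorsII, (2.147) p.248, bookkeeping ours] -/
def nu (cf : ℝ) (i : BondIdx (domT hN D hk)) : ℝ := wt hN D hk cf i / mass hN D hk i

/-- `ν_i·m_i = Λ_i²`. [cite: Balaban1984PropagatorsII, (2.147) p.248, bookkeeping] -/
theorem nu_mul_mass (hℓ : 4 ≤ ℓ) (cf : ℝ) (i : BondIdx (domT hN D hk)) (hper : 2 ≤ (PV d ℓ m K hd hL).sitesPerDir (lvl hN D hk i)) :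
    nu hN D hk cf i * mass hN D hk i = wt hN D hk cf i := by
  unfold nu; exact div_mul_cancel₀ _ (mass_pos hN D hk hℓ i hper).ne'

/-- `ν_i ≥ 0`. [cite: Balaban1984PropagatorsII, (2.147) p.248, bookkeeping] -/
theorem nu_nonneg {cf : ℝ} (hcf : cf ≠ 0) (i : BondIdx (domT hN D hk)) : 0 ≤ nu hN D hk cf i :=
  div_nonneg (wt_pos hN D hk hcf i).le (pair_nonneg hN D hk i i)

/-- `Λ²` depends on the level only. [cite: Balaban1984PropagatorsII, (2.81) p.237, bookkeeping] -/
theorem wt_eq_of_lvl (cf : ℝ) {i i' : BondIdx (B6GlobalChartV1L0.domT hN D hk)} (h : lvl hN D hk i' = lvl hN D hk i) : wt hN D hk cf i' = wt hN D hk cf i := by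
  unfold wt; rw [h]

/-- `Λ_j² = Λ_{j+1}²·L^D/L²`. [cite: Balaban1984PropagatorsII, (2.81) p.237, bookkeeping] -/
theorem wt_succ (cf : ℝ) {i i' : BondIdx (B6GlobalChartV1L0.domT hN D hk)} (h : lvl hN D hk i' = lvl hN D hk i + 1) :
    wt hN D hk cf i = wt hN D hk cf i' * (((ℓ + 1 : ℕ) : ℝ)) ^ (d + 1) / (((ℓ + 1 : ℕ) : ℝ)) ^ 2 := by
  unfold wt; rw [h]
  have hL0 : (((ℓ + 1 : ℕ) : ℝ)) ≠ 0 := by positivity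
  rw [div_pow, div_pow, pow_succ, pow_succ]
  field_simp
  ring

/-- **A SAME-LEVEL PARTNER ROW, WEIGHTED**: `ν_i(Qφ_i)_{i′} ≤ Λ_i²/4` (`i′ ≠ i`, `j(i′) = j(i)`).
[cite: Balaban1984PropagatorsII, (2.147) p.248, bookkeeping] -/
theorem nu_pair_same_le (hℓ : 4 ≤ ℓ) {cf : ℝ} (hcf : cf ≠ 0) (i i' : BondIdx (domT hN D hk))
    (hper : 2 ≤ (PV d ℓ m K hd hL).sitesPerDir (lvl hN D hk i)) (hj : lvl hN D hk i' = lvl hN D hk i) (hne : i' ≠ i) :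
    nu hN D hk cf i * QE (domT hN D hk) (bump hN D hk i) i' ≤ wt hN D hk cf i / 4 := by
  by_cases hc : QE (domT hN D hk) (bump hN D hk i) i' = 0
  · rw [hc, mul_zero]; exact div_nonneg (wt_pos hN D hk hcf i).le (by norm_num)
  have hblk := same_level_block hN D hk i i' hj hc
  have hdir : i'.1.2.dir = i.1.2.dir := (witness_of_pair_ne_zero hN D hk i i' hc).1
  have hper' : 2 ≤ (PV d ℓ m K hd hL).sitesPerDir (lvl hN D hk i') := by rw [hj]; exact hper
  have hp := (partner_le hN D hk hℓ i i' hper' hper hj hdir hne hblk).2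
  have hm := mass_pos hN D hk hℓ i hper
  calc nu hN D hk cf i * QE (domT hN D hk) (bump hN D hk i) i' ≤ nu hN D hk cf i * ((1 / 4) * QE (domT hN D hk) (bump hN D hk i) i) :=
        mul_le_mul_of_nonneg_left hp (nu_nonneg hN D hk hcf i)
    _ = wt hN D hk cf i / 4 := by
        have := nu_mul_mass hN D hk hℓ cf i hper
        unfold mass at this
        linear_combination (1 / 4) * this

/-- **A COARSE ROW, WEIGHTED**: `ν_i(Qφ_i)_{i′} ≤ (5/4)L^{−D}·Λ_i²` (`j(i′) = j(i) + 1`).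
[cite: Balaban1984PropagatorsII, (2.147) p.248, bookkeeping] -/
theorem nu_pair_coarse_le (hℓ : 4 ≤ ℓ) {cf : ℝ} (hcf : cf ≠ 0) (i i' : BondIdx (domT hN D hk))
    (hper : 2 ≤ (PV d ℓ m K hd hL).sitesPerDir (lvl hN D hk i)) (hj : lvl hN D hk i' = lvl hN D hk i + 1) :
    nu hN D hk cf i * QE (domT hN D hk) (bump hN D hk i) i' ≤ (5 / 4) * ((((ℓ + 1 : ℕ) : ℝ)) ^ (d + 1))⁻¹ * wt hN D hk cf i := by
  set j := lvl hN D hk i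
  set Lr : ℝ := ((ℓ + 1 : ℕ) : ℝ)
  set A : ℝ := (Lr ^ (d + 1)) ^ j with hA
  set Sr : ℝ := Lr ^ j with hSr
  set M : ℝ := tsumL hN D hk i * Tsum (ℓ := ℓ) j ^ d
  set r : ℝ := (rad hN D hk i : ℝ)
  have hL0 : 0 < Lr := by positivity
  have hA0 : 0 < A := by positivity
  have hS0 : 0 < Sr := by positivity
  have hm := mass_pos hN D hk hℓ i hper
  have hmass : QE (domT hN D hk) (bump hN D hk i) i * (A * Sr) = (Sr - r) * M := mass_mul hN D hk hℓ i hper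
  have h5 : 5 * r ≤ Sr := by
    have h' : ((5 * rad hN D hk i : ℕ) : ℝ) ≤ (((ℓ + 1) ^ j : ℕ) : ℝ) := by exact_mod_cast five_mul_rad_le hN D hk i
    rw [Nat.cast_pow, Nat.cast_mul, show ((5 : ℕ) : ℝ) = 5 by norm_num] at h'
    exact h'
  have hM0 : 0 ≤ M := mul_nonneg (Finset.sum_nonneg fun t _ => tauL_nonneg hN D hk i t) (pow_nonneg (Tsum_pos (ℓ := ℓ) j).le _)
  -- `M ≤ (5/4)·A·m`
  have hMle : M ≤ (5 / 4) * A * QE (domT hN D hk) (bump hN D hk i) i := by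
    have h1 : Sr * M ≤ (5 / 4) * ((Sr - r) * M) := by nlinarith
    rw [← hmass] at h1
    have h2 : Sr * M ≤ Sr * ((5 / 4) * A * QE (domT hN D hk) (bump hN D hk i) i) := h1.trans (le_of_eq (by ring))
    exact le_of_mul_le_mul_left h2 hS0
  have hc := pair_le hN D hk i i'
  rw [abs_of_nonneg (pair_nonneg hN D hk i i'), hj, pow_succ] at hc
  have hν := nu_nonneg hN D hk hcf i
  calc nu hN D hk cf i * QE (domT hN D hk) (bump hN D hk i) i'
      ≤ nu hN D hk cf i * ((A * Lr ^ (d + 1))⁻¹ * M) := mul_le_mul_of_nonneg_left hc hν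
    _ ≤ nu hN D hk cf i * ((A * Lr ^ (d + 1))⁻¹ * ((5 / 4) * A * QE (domT hN D hk) (bump hN D hk i) i)) :=
        mul_le_mul_of_nonneg_left (mul_le_mul_of_nonneg_left hMle (by positivity)) hν
    _ = (5 / 4) * (Lr ^ (d + 1))⁻¹ * (nu hN D hk cf i * mass hN D hk i) := by unfold mass; field_simp
    _ = _ := by rw [nu_mul_mass hN D hk hℓ cf i hper]

end Pairs2

/-! ## §7c  The test map `Φv = Σ_i v_iν_iφ_i` and the dominance bound `⟨QΦv, v⟩ ≥ ⅛·Σ_iΛ_i²v_i²` -/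

section Dominance

open B5Eq118OneStroke (iterBlock iterBlockOf mem_iterBlock)
open B6MultiLevelBoxOperator (N0)
open B6MultiLevelTorusOperatorL0 (TDomains)
open B6GlobalChartV1 (PV)
open B6GlobalChartV1L0 (domT)
open B6SectAOperatorsV1 (inner_eq_sum)
open B6Prop27KLevelV1L0 (wt wt_pos)
open B6Ineq2142KLevelV1 (cQ cQ_pos)
open B6Ineq2142KLevelV1L0 (lvl lvl_le lvl_le_mK base)

variable {d ℓ m K : ℕ} {hd : 1 ≤ d + 1} {hL : Odd (ℓ + 1) ∧ 1 < ℓ + 1}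
variable {Mh k R : ℕ} {P' : Fin (d + 1) → ℕ}
variable (hN : ∀ μ, N0 ℓ Mh k P' μ = (PV d ℓ m K hd hL).sitesPerDir 0) (D : TDomains d ℓ Mh k P' R) (hk : k ≤ m + K)

/-- **THE TEST MAP** `Φv = Σ_i v_i ν_i φ_i`. [cite: Balaban1984PropagatorsII, (2.147) p.248, bookkeeping ours] -/
def Phi (cf : ℝ) : BondIdxSpace (domT hN D hk) →ₗ[ℝ] BondSpace (PV d ℓ m K hd hL) where
  toFun v := ∑ i, (v i * nu hN D hk cf i) • bump hN D hk i
  map_add' v v' := by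
    rw [← Finset.sum_add_distrib]
    exact Finset.sum_congr rfl fun i _ => by rw [PiLp.add_apply, add_mul, add_smul]
  map_smul' c v := by
    rw [RingHom.id_apply, Finset.smul_sum]
    exact Finset.sum_congr rfl fun i _ => by rw [PiLp.smul_apply, smul_eq_mul, smul_smul, mul_assoc]

/-- `Φv` as a sum. [cite: Balaban1984PropagatorsII, (2.147) p.248, bookkeeping] -/
theorem Phi_apply (cf : ℝ) (v : BondIdxSpace (domT hN D hk)) :
    Phi hN D hk cf v = ∑ i, (v i * nu hN D hk cf i) • bump hN D hk i := rfl

/-- `⟨QΦv, v⟩ = Σ_iΣ_{i′} v_iν_i(Qφ_i)_{i′}v_{i′}`. [cite: Balaban1984PropagatorsII, (2.147) p.248, bookkeeping] -/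
theorem inner_QPhi (cf : ℝ) (v : BondIdxSpace (domT hN D hk)) :
    ⟪QE (domT hN D hk) (Phi hN D hk cf v), v⟫_ℝ = ∑ i, ∑ i', v i * nu hN D hk cf i * QE (domT hN D hk) (bump hN D hk i) i' * v i' := by
  rw [Phi_apply, map_sum, sum_inner]
  refine Finset.sum_congr rfl fun i _ => ?_
  rw [map_smul, real_inner_smul_left, inner_eq_sum, Finset.mul_sum]
  exact Finset.sum_congr rfl fun i' _ => by ring

/-- error density 1 (same level, own coordinate). [cite: Balaban1984PropagatorsII, (2.147) p.248, bookkeeping ours] -/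
def E1 (cf : ℝ) (v : BondIdxSpace (domT hN D hk)) (i i' : BondIdx (domT hN D hk)) : ℝ :=
  if lvl hN D hk i' = lvl hN D hk i ∧ i' ≠ i then (1 / 2) * v i ^ 2 * (nu hN D hk cf i * QE (domT hN D hk) (bump hN D hk i) i') else 0

/-- error density 2 (same level, partner coordinate). [cite: Balaban1984PropagatorsII, (2.147) p.248, bookkeeping ours] -/
def E2 (cf : ℝ) (v : BondIdxSpace (domT hN D hk)) (i i' : BondIdx (domT hN D hk)) : ℝ :=
  if lvl hN D hk i' = lvl hN D hk i ∧ i' ≠ i then (1 / 2) * v i' ^ 2 * (nu hN D hk cf i * QE (domT hN D hk) (bump hN D hk i) i') else 0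

/-- error density 3 (coarse row, fine coordinate). [cite: Balaban1984PropagatorsII, (2.147) p.248, bookkeeping ours] -/
def E3 (cf : ℝ) (v : BondIdxSpace (domT hN D hk)) (i i' : BondIdx (domT hN D hk)) : ℝ :=
  if lvl hN D hk i' = lvl hN D hk i + 1 ∧ QE (domT hN D hk) (bump hN D hk i) i' ≠ 0 then wt hN D hk cf i * v i ^ 2 / 8 else 0

/-- error density 4 (coarse row, coarse coordinate). [cite: Balaban1984PropagatorsII, (2.147) p.248, bookkeeping ours] -/
def E4 (cf : ℝ) (v : BondIdxSpace (domT hN D hk)) (i i' : BondIdx (domT hN D hk)) : ℝ :=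
  if lvl hN D hk i' = lvl hN D hk i + 1 ∧ QE (domT hN D hk) (bump hN D hk i) i' ≠ 0 then 2 * kap d ℓ ^ 2 * wt hN D hk cf i * v i' ^ 2 else 0

variable (hℓ : 4 ≤ ℓ) (hRM : 2 ≤ R * Mh) (hper : ∀ n, n ≤ k + 1 → 2 ≤ (PV d ℓ m K hd hL).sitesPerDir n)
  {cf : ℝ} (hcf : cf ≠ 0)
include hℓ hRM hper hcf

omit hRM in
/-- the period hypothesis at the level of an index bond. [cite: Balaban1984PropagatorsII, (2.3) p.224, bookkeeping] -/
theorem hper_lvl (i : BondIdx (B6GlobalChartV1L0.domT hN D hk)) : 2 ≤ (PV d ℓ m K hd hL).sitesPerDir (lvl hN D hk i) :=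
  hper _ (by have := lvl_le hN D hk i; have := hcf; have := hℓ; omega)

/-- **THE POINTWISE LOWER BOUND** for the `(i, i′)` term of `⟨QΦv, v⟩`. [cite: Balaban1984PropagatorsII, (2.147) p.248, bookkeeping] -/
theorem term_lower (v : BondIdxSpace (domT hN D hk)) (i i' : BondIdx (domT hN D hk)) :
    (if i' = i then wt hN D hk cf i * v i ^ 2 else 0) - E1 hN D hk cf v i i' - E2 hN D hk cf v i i' - E3 hN D hk cf v i i' - E4 hN D hk cf v i i' ≤
      v i * nu hN D hk cf i * QE (domT hN D hk) (bump hN D hk i) i' * v i' := by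
  have hperi := hper_lvl hN D hk hℓ hper hcf i
  have hW0 := wt_pos hN D hk hcf i
  have hν0 := nu_nonneg hN D hk hcf i
  have hc0 := pair_nonneg hN D hk i i'
  have ha0 : 0 ≤ nu hN D hk cf i * QE (domT hN D hk) (bump hN D hk i) i' := mul_nonneg hν0 hc0
  have h1n : 0 ≤ E1 hN D hk cf v i i' := by
    unfold E1; split_ifs
    · exact mul_nonneg (mul_nonneg (by norm_num) (sq_nonneg _)) ha0
    · exact le_rfl
  have h2n : 0 ≤ E2 hN D hk cf v i i' := by
    unfold E2; split_ifs
    · exact mul_nonneg (mul_nonneg (by norm_num) (sq_nonneg _)) ha0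
    · exact le_rfl
  have h3n : 0 ≤ E3 hN D hk cf v i i' := by
    unfold E3; split_ifs
    · exact div_nonneg (mul_nonneg hW0.le (sq_nonneg _)) (by norm_num)
    · exact le_rfl
  have h4n : 0 ≤ E4 hN D hk cf v i i' := by
    unfold E4; split_ifs
    · exact mul_nonneg (mul_nonneg (mul_nonneg (by norm_num) (sq_nonneg _)) hW0.le) (sq_nonneg _)
    · exact le_rfl
  by_cases hii : i' = i
  · subst hii
    rw [if_pos rfl]
    have e : v i' * nu hN D hk cf i' * QE (domT hN D hk) (bump hN D hk i') i' * v i' = wt hN D hk cf i' * v i' ^ 2 := by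
      have h := nu_mul_mass hN D hk hℓ cf i' hperi
      unfold mass at h
      linear_combination v i' ^ 2 * h
    rw [e]; linarith
  rw [if_neg hii]
  by_cases hj : lvl hN D hk i' = lvl hN D hk i
  · have e1 : E1 hN D hk cf v i i' = (1 / 2) * v i ^ 2 * (nu hN D hk cf i * QE (domT hN D hk) (bump hN D hk i) i') := by
      unfold E1; rw [if_pos ⟨hj, hii⟩]
    have e2 : E2 hN D hk cf v i i' = (1 / 2) * v i' ^ 2 * (nu hN D hk cf i * QE (domT hN D hk) (bump hN D hk i) i') := by
      unfold E2; rw [if_pos ⟨hj, hii⟩]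
    have h := amgm_same (v i) (v i') _ ha0
    rw [e1, e2]; nlinarith
  by_cases hj1 : lvl hN D hk i' = lvl hN D hk i + 1
  · by_cases hcz : QE (domT hN D hk) (bump hN D hk i) i' = 0
    · rw [hcz, mul_zero, zero_mul]; linarith
    have e3 : E3 hN D hk cf v i i' = wt hN D hk cf i * v i ^ 2 / 8 := by unfold E3; rw [if_pos ⟨hj1, hcz⟩]
    have e4 : E4 hN D hk cf v i i' = 2 * kap d ℓ ^ 2 * wt hN D hk cf i * v i' ^ 2 := by unfold E4; rw [if_pos ⟨hj1, hcz⟩]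
    have ha : nu hN D hk cf i * QE (domT hN D hk) (bump hN D hk i) i' ≤ kap d ℓ * wt hN D hk cf i :=
      nu_pair_coarse_le hN D hk hℓ hcf i i' hperi hj1
    have h := amgm_coarse (v i) (v i') (nu hN D hk cf i * QE (domT hN D hk) (bump hN D hk i) i') _ hW0
    have hsq : (nu hN D hk cf i * QE (domT hN D hk) (bump hN D hk i) i') ^ 2 ≤ (kap d ℓ * wt hN D hk cf i) ^ 2 := pow_le_pow_left₀ ha0 ha 2
    have hdiv : 2 * (nu hN D hk cf i * QE (domT hN D hk) (bump hN D hk i) i') ^ 2 / wt hN D hk cf i * v i' ^ 2 ≤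
        2 * kap d ℓ ^ 2 * wt hN D hk cf i * v i' ^ 2 := by
      rw [div_mul_eq_mul_div, div_le_iff₀ hW0]
      nlinarith [sq_nonneg (v i')]
    rw [e3, e4]; nlinarith
  · have hcz : QE (domT hN D hk) (bump hN D hk i) i' = 0 := by
      by_contra hne
      have hw := level_window hN D hk hRM i i' hne
      omega
    rw [hcz, mul_zero, zero_mul]; linarith

omit hRM in
/-- `ΣΣE1 ≤ ⅛ΣΛ²v²`. [cite: Balaban1984PropagatorsII, (2.147) p.248, bookkeeping] -/
theorem sum_E1_le (v : BondIdxSpace (domT hN D hk)) :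
    ∑ i, ∑ i', E1 hN D hk cf v i i' ≤ (1 / 8) * ∑ i, wt hN D hk cf i * v i ^ 2 := by
  classical
  rw [Finset.mul_sum]
  refine Finset.sum_le_sum fun i _ => ?_
  have hperi := hper_lvl hN D hk hℓ hper hcf i
  unfold E1
  rw [← Finset.sum_filter]
  have h := same_level_sum_le hN D hk hℓ i hperi
  have hν0 := nu_nonneg hN D hk hcf i
  have hm := nu_mul_mass hN D hk hℓ cf i hperi
  unfold mass at hm
  rw [show ∑ i' ∈ Finset.univ.filter (fun i' => lvl hN D hk i' = lvl hN D hk i ∧ i' ≠ i),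
      (1 / 2) * v i ^ 2 * (nu hN D hk cf i * QE (domT hN D hk) (bump hN D hk i) i') =
      (1 / 2) * v i ^ 2 * nu hN D hk cf i * ∑ i' ∈ Finset.univ.filter (fun i' => lvl hN D hk i' = lvl hN D hk i ∧ i' ≠ i),
        QE (domT hN D hk) (bump hN D hk i) i' by rw [Finset.mul_sum]; exact Finset.sum_congr rfl fun _ _ => by ring]
  calc _ ≤ (1 / 2) * v i ^ 2 * nu hN D hk cf i * ((1 / 4) * QE (domT hN D hk) (bump hN D hk i) i) :=
        mul_le_mul_of_nonneg_left h (mul_nonneg (mul_nonneg (by norm_num) (sq_nonneg _)) hν0)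
    _ = (1 / 8) * (wt hN D hk cf i * v i ^ 2) := by linear_combination (1 / 8) * v i ^ 2 * hm

omit hRM in
/-- `ΣΣE2 ≤ ¼ΣΛ²v²`. [cite: Balaban1984PropagatorsII, (2.147) p.248, bookkeeping] -/
theorem sum_E2_le (v : BondIdxSpace (domT hN D hk)) :
    ∑ i, ∑ i', E2 hN D hk cf v i i' ≤ (1 / 4) * ∑ i, wt hN D hk cf i * v i ^ 2 := by
  classical
  rw [Finset.sum_comm, Finset.mul_sum]
  refine Finset.sum_le_sum fun i' _ => ?_
  -- termwise: `E2 i i′ ≤ [j(i) = j(i′), i ≠ i′, row ≠ 0]·(1/2)v_{i′}²·Λ_{i′}²/4`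
  have hb : ∀ i, E2 hN D hk cf v i i' ≤
      if lvl hN D hk i = lvl hN D hk i' ∧ i ≠ i' ∧ QE (domT hN D hk) (bump hN D hk i) i' ≠ 0 then (1 / 2) * v i' ^ 2 * (wt hN D hk cf i' / 4) else 0 := by
    intro i
    have hperi := hper_lvl hN D hk hℓ hper hcf i
    unfold E2
    by_cases h1 : lvl hN D hk i' = lvl hN D hk i ∧ i' ≠ i
    · rw [if_pos h1]
      by_cases h2 : QE (domT hN D hk) (bump hN D hk i) i' = 0
      · rw [if_neg (fun h => h.2.2 h2), h2]; simp
      · rw [if_pos ⟨h1.1.symm, fun h => h1.2 h.symm, h2⟩]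
        have h := nu_pair_same_le hN D hk hℓ hcf i i' hperi h1.1 h1.2
        rw [← wt_eq_of_lvl hN D hk cf h1.1] at h
        exact mul_le_mul_of_nonneg_left h (mul_nonneg (by norm_num) (sq_nonneg _))
    · rw [if_neg h1, if_neg (fun h => h1 ⟨h.1.symm, fun h' => h.2.1 h'.symm⟩)]
  refine (Finset.sum_le_sum fun i _ => hb i).trans ?_
  rw [← Finset.sum_filter, Finset.sum_const, nsmul_eq_mul]
  have hcard' : ((Finset.univ.filter (fun i => lvl hN D hk i = lvl hN D hk i' ∧ i ≠ i' ∧ QE (domT hN D hk) (bump hN D hk i) i' ≠ 0)).card : ℝ) ≤ 2 := by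
    exact_mod_cast card_same_level_le hN D hk i'
  have : 0 ≤ (1 / 2) * v i' ^ 2 * (wt hN D hk cf i' / 4) := by have := wt_pos hN D hk hcf i'; positivity
  nlinarith

omit hℓ hRM hper in
/-- `ΣΣE3 ≤ ¼ΣΛ²v²`. [cite: Balaban1984PropagatorsII, (2.147) p.248, bookkeeping] -/
theorem sum_E3_le (v : BondIdxSpace (domT hN D hk)) :
    ∑ i, ∑ i', E3 hN D hk cf v i i' ≤ (1 / 4) * ∑ i, wt hN D hk cf i * v i ^ 2 := by
  classical
  rw [Finset.mul_sum]
  refine Finset.sum_le_sum fun i _ => ?_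
  unfold E3
  rw [← Finset.sum_filter, Finset.sum_const, nsmul_eq_mul]
  have hcard' : ((Finset.univ.filter (fun i' => lvl hN D hk i' = lvl hN D hk i + 1 ∧ QE (domT hN D hk) (bump hN D hk i) i' ≠ 0)).card : ℝ) ≤ 2 := by
    exact_mod_cast card_coarse_rows_le hN D hk i
  have : 0 ≤ wt hN D hk cf i * v i ^ 2 / 8 := by have := wt_pos hN D hk hcf i; positivity
  nlinarith

omit hRM hper in
/-- `ΣΣE4 ≤ ¼ΣΛ²v²` (`L ≥ 5`). [cite: Balaban1984PropagatorsII, (2.147) p.248, bookkeeping] -/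
theorem sum_E4_le (v : BondIdxSpace (domT hN D hk)) :
    ∑ i, ∑ i', E4 hN D hk cf v i i' ≤ (1 / 4) * ∑ i, wt hN D hk cf i * v i ^ 2 := by
  classical
  set Lr : ℝ := ((ℓ + 1 : ℕ) : ℝ) with hLr
  have hL5 : (5 : ℝ) ≤ Lr := by simp only [hLr]; exact_mod_cast (by omega : 5 ≤ ℓ + 1)
  have hLD : 0 < Lr ^ (d + 1) := by positivity
  rw [Finset.sum_comm, Finset.mul_sum]
  refine Finset.sum_le_sum fun i' _ => ?_
  have hW0 := wt_pos hN D hk hcf i'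
  unfold E4
  rw [← Finset.sum_filter]
  set F := Finset.univ.filter (fun i => lvl hN D hk i' = lvl hN D hk i + 1 ∧ QE (domT hN D hk) (bump hN D hk i) i' ≠ 0) with hF
  have e : ∑ i ∈ F, 2 * kap d ℓ ^ 2 * wt hN D hk cf i * v i' ^ 2 =
      (F.card : ℝ) * (2 * kap d ℓ ^ 2 * (wt hN D hk cf i' * Lr ^ (d + 1) / Lr ^ 2) * v i' ^ 2) := by
    rw [← nsmul_eq_mul, ← Finset.sum_const]
    refine Finset.sum_congr rfl fun i hi => ?_
    rw [hF, Finset.mem_filter] at hi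
    rw [wt_succ hN D hk cf hi.2.1]
  rw [e]
  have hpos : 0 ≤ 2 * kap d ℓ ^ 2 * (wt hN D hk cf i' * Lr ^ (d + 1) / Lr ^ 2) * v i' ^ 2 := by unfold kap; positivity
  -- LEVEL-0 TWIN (joint J7): `card_fine_seen_le` is guard-free (a level-1 row sees `≤ 2L^D` level-0 bumps, a level-0 row none)
  have hcard' : (F.card : ℝ) ≤ 2 * Lr ^ (d + 1) := by
    have := (Nat.cast_le (α := ℝ)).2 (card_fine_seen_le hN D hk i')
    rw [hLr]; push_cast at this ⊢; exact this
  refine (mul_le_mul_of_nonneg_right hcard' hpos).trans ?_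
  have hWv : 0 ≤ wt hN D hk cf i' * v i' ^ 2 := mul_nonneg hW0.le (sq_nonneg _)
  have e2 : 2 * Lr ^ (d + 1) * (2 * kap d ℓ ^ 2 * (wt hN D hk cf i' * Lr ^ (d + 1) / Lr ^ 2) * v i' ^ 2) =
      (25 / 4) / Lr ^ 2 * (wt hN D hk cf i' * v i' ^ 2) := by
    unfold kap; rw [← hLr]; field_simp; ring
  rw [e2]
  have : (25 / 4) / Lr ^ 2 ≤ 1 / 4 := by rw [div_le_iff₀ (by positivity)]; nlinarith
  exact mul_le_mul_of_nonneg_right this hWv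

/-- **THE DOMINANCE BOUND**: `⟨QΦv, v⟩ ≥ ⅛·Σ_iΛ_i²v_i²` (`L ≥ 5`).
[cite: Balaban1984PropagatorsII, (2.147) p.248, bookkeeping] -/
theorem dominance (v : BondIdxSpace (domT hN D hk)) :
    (1 / 8) * ∑ i, wt hN D hk cf i * v i ^ 2 ≤ ⟪QE (domT hN D hk) (Phi hN D hk cf v), v⟫_ℝ := by
  classical
  rw [inner_QPhi]
  have hsum := Finset.sum_le_sum fun i (_ : i ∈ Finset.univ) => Finset.sum_le_sum fun i' (_ : i' ∈ Finset.univ) =>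
    term_lower hN D hk hℓ hRM hper hcf v i i'
  refine le_trans ?_ hsum
  simp only [Finset.sum_sub_distrib]
  rw [Finset.sum_congr rfl fun i _ => Finset.sum_ite_eq' Finset.univ i (fun _ => wt hN D hk cf i * v i ^ 2)]
  simp only [Finset.mem_univ, if_true]
  have h1 := sum_E1_le hN D hk hℓ hper hcf v
  have h2 := sum_E2_le hN D hk hℓ hper hcf v
  have h3 := sum_E3_le hN D hk hcf v
  have h4 := sum_E4_le hN D hk hℓ hcf v
  linarith

end Dominance

/-! ## §7d  The energy of `Φv` -/

section EnergyPhi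

open B5Eq118OneStroke (iterBlock iterBlockOf mem_iterBlock)
open B6MultiLevelBoxOperator (N0)
open B6MultiLevelTorusOperatorL0 (TDomains)
open B6GlobalChartV1 (PV)
open B6GlobalChartV1L0 (domT)
open B6SectAOperatorsV1 (inner_eq_sum)
open B6Prop27KLevelV1L0 (wt wt_pos)
open B6Ineq2142KLevelV1 (cQ cQ_pos)
open B6Ineq2142KLevelV1L0 (lvl lvl_le lvl_le_mK base)

variable {d ℓ m K : ℕ} {hd : 1 ≤ d + 1} {hL : Odd (ℓ + 1) ∧ 1 < ℓ + 1}
variable {Mh k R : ℕ} {P' : Fin (d + 1) → ℕ}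
variable (hN : ∀ μ, N0 ℓ Mh k P' μ = (PV d ℓ m K hd hL).sitesPerDir 0) (D : TDomains d ℓ Mh k P' R) (hk : k ≤ m + K)

/-- `Φv` evaluated at a bond. [cite: Balaban1984PropagatorsII, (2.147) p.248, bookkeeping] -/
theorem Phi_eval (cf : ℝ) (v : BondIdxSpace (domT hN D hk)) (f : PBond (PV d ℓ m K hd hL) 0) :
    Phi hN D hk cf v f = ∑ i, (v i * nu hN D hk cf i) * bump hN D hk i f := by
  rw [Phi_apply, WithLp.ofLp_sum, Finset.sum_apply]
  simp only [WithLp.ofLp_smul, Pi.smul_apply, smul_eq_mul]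

/-- `Δ_ν` of `Φv`. [cite: Balaban1984PropagatorsII, (2.147) p.248, bookkeeping] -/
theorem bdiff_Phi (cf : ℝ) (v : BondIdxSpace (domT hN D hk)) (ν : Fin (d + 1)) (f : PBond (PV d ℓ m K hd hL) 0) :
    bdiff (Phi hN D hk cf v) ν f = ∑ i, (v i * nu hN D hk cf i) * bdiff (bump hN D hk i) ν f := by
  unfold bdiff
  rw [Phi_eval, Phi_eval, ← Finset.sum_sub_distrib]
  exact Finset.sum_congr rfl fun i _ => by ring

/-- `QΦv` at an index bond. [cite: Balaban1984PropagatorsII, (2.147) p.248, bookkeeping] -/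
theorem QE_Phi (cf : ℝ) (v : BondIdxSpace (domT hN D hk)) (i' : BondIdx (domT hN D hk)) :
    QE (domT hN D hk) (Phi hN D hk cf v) i' = ∑ i, (v i * nu hN D hk cf i) * QE (domT hN D hk) (bump hN D hk i) i' := by
  rw [Phi_apply, map_sum, WithLp.ofLp_sum, Finset.sum_apply]
  simp only [map_smul, WithLp.ofLp_smul, Pi.smul_apply, smul_eq_mul]

variable (hℓ : 4 ≤ ℓ) (hRM : 2 ≤ R * Mh) (hper : ∀ n, n ≤ k + 1 → 2 ≤ (PV d ℓ m K hd hL).sitesPerDir n)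
  {cf : ℝ} (hcf : cf ≠ 0) {b₁ : ℝ} (hb₁ : 0 ≤ b₁) {w : BondIdx (domT hN D hk) → ℝ} (hw : ∀ i, 0 < w i)
  (hwup : ∀ i', w i' ≤ b₁ * cf ^ 2 * (((ℓ + 1 : ℕ) : ℝ) ^ (d + 1)) ^ (lvl hN D hk i') / ((((ℓ + 1 : ℕ) : ℝ)) ^ (lvl hN D hk i')) ^ 2)
include hℓ hRM hper hcf hb₁ hw hwup

omit hRM hb₁ hw hwup in
/-- `ν_i²·c_f²·G_i ≤ C_∇·Λ_i²`. [cite: Balaban1984PropagatorsII, (2.147) p.248, bookkeeping] -/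
theorem nu_sq_grad_le (i : BondIdx (domT hN D hk)) :
    nu hN D hk cf i ^ 2 * (cf ^ 2 * ∑ f : PBond (PV d ℓ m K hd hL) 0, ∑ ν : Fin (d + 1), bdiff (bump hN D hk i) ν f ^ 2) ≤
      Cgrad d * wt hN D hk cf i := by
  have hperi := hper_lvl hN D hk hℓ hper hcf i
  have h := gpart_hom hN D hk hℓ hcf i hperi
  have hm := mass_pos hN D hk hℓ i hperi
  have hW := wt_pos hN D hk hcf i
  have hG : 0 ≤ cf ^ 2 * ∑ f : PBond (PV d ℓ m K hd hL) 0, ∑ ν : Fin (d + 1), bdiff (bump hN D hk i) ν f ^ 2 :=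
    mul_nonneg (sq_nonneg _) (Finset.sum_nonneg fun _ _ => Finset.sum_nonneg fun _ _ => sq_nonneg _)
  unfold nu mass
  rw [div_pow, div_mul_eq_mul_div, div_le_iff₀ (by positivity)]
  calc wt hN D hk cf i ^ 2 * (cf ^ 2 * ∑ f : PBond (PV d ℓ m K hd hL) 0, ∑ ν : Fin (d + 1), bdiff (bump hN D hk i) ν f ^ 2)
      = wt hN D hk cf i * (wt hN D hk cf i * (cf ^ 2 * ∑ f : PBond (PV d ℓ m K hd hL) 0, ∑ ν : Fin (d + 1), bdiff (bump hN D hk i) ν f ^ 2)) := by ring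
    _ ≤ wt hN D hk cf i * (Cgrad d * QE (domT hN D hk) (bump hN D hk i) i ^ 2) := mul_le_mul_of_nonneg_left h hW.le
    _ = _ := by ring

omit hw in
/-- `ν_i²·Q_i ≤ (25/8)b₁L^D·Λ_i²`. [cite: Balaban1984PropagatorsII, (2.147) p.248, bookkeeping] -/
theorem nu_sq_q_le (i : BondIdx (domT hN D hk)) :
    nu hN D hk cf i ^ 2 * ∑ i', w i' * QE (domT hN D hk) (bump hN D hk i) i' ^ 2 ≤
      ((25 / 8) * b₁ * (((ℓ + 1 : ℕ) : ℝ)) ^ (d + 1)) * wt hN D hk cf i := by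
  have hperi := hper_lvl hN D hk hℓ hper hcf i
  have h := qpart_hom hN D hk hℓ hRM hper hcf hb₁ hwup i
  have hm := mass_pos hN D hk hℓ i hperi
  have hW := wt_pos hN D hk hcf i
  unfold nu mass
  rw [div_pow, div_mul_eq_mul_div, div_le_iff₀ (by positivity)]
  calc wt hN D hk cf i ^ 2 * ∑ i', w i' * QE (domT hN D hk) (bump hN D hk i) i' ^ 2
      = wt hN D hk cf i * (wt hN D hk cf i * ∑ i', w i' * QE (domT hN D hk) (bump hN D hk i) i' ^ 2) := by ring
    _ ≤ wt hN D hk cf i * (((25 / 8) * b₁ * (((ℓ + 1 : ℕ) : ℝ)) ^ (d + 1)) * QE (domT hN D hk) (bump hN D hk i) i ^ 2) :=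
        mul_le_mul_of_nonneg_left h hW.le
    _ = _ := by ring

/-- **THE ENERGY OF THE TEST VECTOR**: `⟨Φv, Δ_aΦv⟩ ≤ C_E·Σ_iΛ_i²v_i²`. [cite: Balaban1984PropagatorsII, (2.147) p.248, (2.16) p.225, bookkeeping] -/
theorem energy_Phi_le (v : BondIdxSpace (domT hN D hk)) :
    ⟪Phi hN D hk cf v, deltaAE (domT hN D hk) cf w (Phi hN D hk cf v)⟫_ℝ ≤ Cen d ℓ b₁ * ∑ i, wt hN D hk cf i * v i ^ 2 := by
  have hE := energy_le (domT hN D hk) cf w (Phi hN D hk cf v)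
  refine hE.trans ?_
  have hd2 : (((PV d ℓ m K hd hL).d : ℕ) : ℝ) = (d : ℝ) + 1 := by push_cast [show (PV d ℓ m K hd hL).d = d + 1 from rfl]; ring
  rw [hd2]
  set a := fun i : BondIdx (domT hN D hk) => v i * nu hN D hk cf i with ha
  -- gradient part: `Σ_fΣ_ν(Δ_νΦv)² ≤ 4D·Σ_i a_i²·G_i`
  have hgrad : ∑ f : PBond (PV d ℓ m K hd hL) 0, ∑ ν : Fin (d + 1), bdiff (Phi hN D hk cf v) ν f ^ 2 ≤
      ∑ i, (4 * ((d : ℝ) + 1)) * (a i ^ 2 * ∑ f : PBond (PV d ℓ m K hd hL) 0, ∑ ν : Fin (d + 1), bdiff (bump hN D hk i) ν f ^ 2) := by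
    calc ∑ f : PBond (PV d ℓ m K hd hL) 0, ∑ ν : Fin (d + 1), bdiff (Phi hN D hk cf v) ν f ^ 2
        ≤ ∑ f : PBond (PV d ℓ m K hd hL) 0, ∑ ν : Fin (d + 1), ∑ i, (4 * ((d : ℝ) + 1)) * (a i * bdiff (bump hN D hk i) ν f) ^ 2 :=
          Finset.sum_le_sum fun f _ => Finset.sum_le_sum fun ν _ => by
            rw [bdiff_Phi, ← Finset.mul_sum]; exact grad_sq_le hN D hk a f ν
      _ = ∑ i, (4 * ((d : ℝ) + 1)) * (a i ^ 2 * ∑ f : PBond (PV d ℓ m K hd hL) 0, ∑ ν : Fin (d + 1), bdiff (bump hN D hk i) ν f ^ 2) := by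
          rw [Finset.sum_congr rfl fun f _ => Finset.sum_comm, Finset.sum_comm]
          refine Finset.sum_congr rfl fun i _ => ?_
          rw [Finset.mul_sum, Finset.mul_sum]
          refine Finset.sum_congr rfl fun f _ => ?_
          rw [Finset.mul_sum, Finset.mul_sum]
          exact Finset.sum_congr rfl fun ν _ => by ring
  -- `Q` part: `Σ_{i′}w(QΦv)_{i′}² ≤ 4DL^D·Σ_i a_i²·Q_i`
  have hq : ∑ i', w i' * QE (domT hN D hk) (Phi hN D hk cf v) i' ^ 2 ≤
      ∑ i, (4 * ((d : ℝ) + 1) * (((ℓ + 1 : ℕ) : ℝ)) ^ (d + 1)) * (a i ^ 2 * ∑ i', w i' * QE (domT hN D hk) (bump hN D hk i) i' ^ 2) := by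
    calc ∑ i', w i' * QE (domT hN D hk) (Phi hN D hk cf v) i' ^ 2
        ≤ ∑ i', ∑ i, w i' * ((4 * ((d : ℝ) + 1) * (((ℓ + 1 : ℕ) : ℝ)) ^ (d + 1)) * (a i * QE (domT hN D hk) (bump hN D hk i) i') ^ 2) :=
          Finset.sum_le_sum fun i' _ => by
            rw [QE_Phi, ← Finset.mul_sum, ← Finset.mul_sum]
            exact mul_le_mul_of_nonneg_left (qrow_sq_le hN D hk hRM a i') (hw i').le
      _ = _ := by
          rw [Finset.sum_comm]
          refine Finset.sum_congr rfl fun i _ => ?_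
          rw [Finset.mul_sum, Finset.mul_sum]
          exact Finset.sum_congr rfl fun i' _ => by ring
  -- termwise homogeneity
  have hG : ∀ i, cf ^ 2 * (((d : ℝ) + 1) + 2) * ((4 * ((d : ℝ) + 1)) * (a i ^ 2 * ∑ f : PBond (PV d ℓ m K hd hL) 0, ∑ ν : Fin (d + 1), bdiff (bump hN D hk i) ν f ^ 2)) ≤
      (4 * ((d : ℝ) + 1) * (((d : ℝ) + 1) + 2) * Cgrad d) * (wt hN D hk cf i * v i ^ 2) := by
    intro i
    have h := nu_sq_grad_le hN D hk hℓ hper hcf i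
    have hv : 0 ≤ v i ^ 2 * (4 * ((d : ℝ) + 1) * (((d : ℝ) + 1) + 2)) := by positivity
    calc _ = (v i ^ 2 * (4 * ((d : ℝ) + 1) * (((d : ℝ) + 1) + 2))) *
          (nu hN D hk cf i ^ 2 * (cf ^ 2 * ∑ f : PBond (PV d ℓ m K hd hL) 0, ∑ ν : Fin (d + 1), bdiff (bump hN D hk i) ν f ^ 2)) := by
            simp only [ha]; ring
      _ ≤ (v i ^ 2 * (4 * ((d : ℝ) + 1) * (((d : ℝ) + 1) + 2))) * (Cgrad d * wt hN D hk cf i) := mul_le_mul_of_nonneg_left h hv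
      _ = _ := by ring
  have hQ : ∀ i, (4 * ((d : ℝ) + 1) * (((ℓ + 1 : ℕ) : ℝ)) ^ (d + 1)) * (a i ^ 2 * ∑ i', w i' * QE (domT hN D hk) (bump hN D hk i) i' ^ 2) ≤
      (4 * ((d : ℝ) + 1) * (((ℓ + 1 : ℕ) : ℝ)) ^ (d + 1) * ((25 / 8) * b₁ * (((ℓ + 1 : ℕ) : ℝ)) ^ (d + 1))) * (wt hN D hk cf i * v i ^ 2) := by
    intro i
    have h := nu_sq_q_le hN D hk hℓ hRM hper hcf hb₁ hwup i
    have hv : 0 ≤ v i ^ 2 * (4 * ((d : ℝ) + 1) * (((ℓ + 1 : ℕ) : ℝ)) ^ (d + 1)) := by positivity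
    calc _ = (v i ^ 2 * (4 * ((d : ℝ) + 1) * (((ℓ + 1 : ℕ) : ℝ)) ^ (d + 1))) *
          (nu hN D hk cf i ^ 2 * ∑ i', w i' * QE (domT hN D hk) (bump hN D hk i) i' ^ 2) := by simp only [ha]; ring
      _ ≤ (v i ^ 2 * (4 * ((d : ℝ) + 1) * (((ℓ + 1 : ℕ) : ℝ)) ^ (d + 1))) * (((25 / 8) * b₁ * (((ℓ + 1 : ℕ) : ℝ)) ^ (d + 1)) * wt hN D hk cf i) :=
          mul_le_mul_of_nonneg_left h hv
      _ = _ := by ring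
  have hc0 : 0 ≤ cf ^ 2 * (((d : ℝ) + 1) + 2) := by positivity
  calc cf ^ 2 * (((d : ℝ) + 1) + 2) * ∑ f : PBond (PV d ℓ m K hd hL) 0, ∑ ν : Fin (d + 1), bdiff (Phi hN D hk cf v) ν f ^ 2 +
        ∑ i', w i' * QE (domT hN D hk) (Phi hN D hk cf v) i' ^ 2
      ≤ cf ^ 2 * (((d : ℝ) + 1) + 2) * ∑ i, (4 * ((d : ℝ) + 1)) * (a i ^ 2 * ∑ f : PBond (PV d ℓ m K hd hL) 0, ∑ ν : Fin (d + 1), bdiff (bump hN D hk i) ν f ^ 2) +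
        ∑ i, (4 * ((d : ℝ) + 1) * (((ℓ + 1 : ℕ) : ℝ)) ^ (d + 1)) * (a i ^ 2 * ∑ i', w i' * QE (domT hN D hk) (bump hN D hk i) i' ^ 2) :=
        add_le_add (mul_le_mul_of_nonneg_left hgrad hc0) hq
    _ = ∑ i, cf ^ 2 * (((d : ℝ) + 1) + 2) * ((4 * ((d : ℝ) + 1)) * (a i ^ 2 * ∑ f : PBond (PV d ℓ m K hd hL) 0, ∑ ν : Fin (d + 1), bdiff (bump hN D hk i) ν f ^ 2)) +
        ∑ i, (4 * ((d : ℝ) + 1) * (((ℓ + 1 : ℕ) : ℝ)) ^ (d + 1)) * (a i ^ 2 * ∑ i', w i' * QE (domT hN D hk) (bump hN D hk i) i' ^ 2) := by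
        rw [Finset.mul_sum]
    _ ≤ ∑ i, (4 * ((d : ℝ) + 1) * (((d : ℝ) + 1) + 2) * Cgrad d) * (wt hN D hk cf i * v i ^ 2) +
        ∑ i, (4 * ((d : ℝ) + 1) * (((ℓ + 1 : ℕ) : ℝ)) ^ (d + 1) * ((25 / 8) * b₁ * (((ℓ + 1 : ℕ) : ℝ)) ^ (d + 1))) * (wt hN D hk cf i * v i ^ 2) :=
        add_le_add (Finset.sum_le_sum fun i _ => hG i) (Finset.sum_le_sum fun i _ => hQ i)
    _ = Cen d ℓ b₁ * ∑ i, wt hN D hk cf i * v i ^ 2 := by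
        unfold Cen; rw [← Finset.mul_sum, ← Finset.mul_sum]; ring

end EnergyPhi

/-! ## §7e  The global coercivity (2.147) and Proposition 2.7 (2.149) without the coercivity hypothesis -/

section Final

open B5Eq118OneStroke (iterBlock iterBlockOf mem_iterBlock)
open B6MultiLevelBoxOperator (N0)
open B6MultiLevelTorusOperatorL0 (TDomains)
open B6GlobalChartV1 (PV)
open B6GlobalChartV1L0 (domT)
open B6Geom246MultiLevelTorusL0 (geomT)
open B6RandomWalk (delta3)
open B6SectAVectorModelV1 (EE)
open B6Prop27KLevelV1L0 (wt wt_pos lam)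
open B6Ineq2142KLevelV1L0 (lvl lvl_le lvl_le_mK base β)
open B6CubeWindowV1 (Placed GlobalBand)
open B6Cover236MultiLevelBlocksL0 (cubes)

variable {d ℓ m K : ℕ} {hd : 1 ≤ d + 1} {hL : Odd (ℓ + 1) ∧ 1 < ℓ + 1}
variable {Mh k R : ℕ} {P' : Fin (d + 1) → ℕ}
variable (hN : ∀ μ, N0 ℓ Mh k P' μ = (PV d ℓ m K hd hL).sitesPerDir 0) (D : TDomains d ℓ Mh k P' R) (hk : k ≤ m + K)

/-- **THE GLOBAL LEVEL-WEIGHTED COERCIVITY (2.147) AT `k` LEVELS**: on ROUTE V's torus, for `L ≥ 5`, `k ≥ 1`, `R·M̂ ≥ 2`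
and weights `0 < w_i ≤ b₁c_f²(L^D)^{j}/(L^{j})²`,
`γ₀·Σ_i Λ_i²v_i² ≤ ⟨Q*v, GQ*v⟩` with `γ₀ = γ₀(d, L, b₁)` INDEPENDENT OF `k` — the print's «⟨B,(QGQ*)B⟩ ≥ γ₀‖B‖² (2.147) with a
positive constant γ₀ depending on d and L only» in the variables of the torus model (the print's `B` is in rescaled units; here the
level weights `Λ_i² = (L^{j(i)}/c_f)²·L^{−j(i)D}` carry the rescaling, and `b₁` enters because `w` is only assumed in the band (2.16)).
[cite: Balaban1984PropagatorsII, (2.147) p.248] -/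
theorem qgq_coercive_kLevel (hℓ : 4 ≤ ℓ) (hRM : 2 ≤ R * Mh) {cf : ℝ} (hcf : cf ≠ 0) {b₁ : ℝ} (hb₁ : 0 ≤ b₁)
    {w : BondIdx (domT hN D hk) → ℝ} (hw : ∀ i, 0 < w i)
    (hwup : ∀ i', w i' ≤ b₁ * cf ^ 2 * (((ℓ + 1 : ℕ) : ℝ) ^ (d + 1)) ^ (lvl hN D hk i') / ((((ℓ + 1 : ℕ) : ℝ)) ^ (lvl hN D hk i')) ^ 2)
    (v : BondIdxSpace (domT hN D hk)) :
    gam0 d ℓ b₁ * ∑ i, wt hN D hk cf i * v i ^ 2 ≤ ⟪QsE (domT hN D hk) v, GE (domT hN D hk) hcf hw (QsE (domT hN D hk) v)⟫_ℝ :=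
  qgq_coercive_of_test_map (domT hN D hk) hcf hw (Phi hN D hk cf) (fun v => ∑ i, wt hN D hk cf i * v i ^ 2)
    (fun v => Finset.sum_nonneg fun i _ => mul_nonneg (wt_pos hN D hk hcf i).le (sq_nonneg _)) (by norm_num) (Cen_pos d ℓ hb₁)
    (dominance hN D hk hℓ hRM (fun n _ => Nat.succ_le_of_lt ((PV d ℓ m K hd hL).one_lt_sitesPerDir n)) hcf)
    (energy_Phi_le hN D hk hℓ hRM (fun n _ => Nat.succ_le_of_lt ((PV d ℓ m K hd hL).one_lt_sitesPerDir n)) hcf hb₁ hw hwup) v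

/-- the global band (2.16) gives the upper weight bound used above. [cite: Balaban1984PropagatorsII, (2.16) p.225, bookkeeping] -/
theorem hwup_of_globalBand {b₀ b₁ cf : ℝ} (hcf : cf ≠ 0) {w : BondIdx (B6GlobalChartV1L0.domT hN D hk) → ℝ} (hB : GlobalBand b₀ b₁ cf w)
    (i' : BondIdx (domT hN D hk)) :
    w i' ≤ b₁ * cf ^ 2 * (((ℓ + 1 : ℕ) : ℝ) ^ (d + 1)) ^ (lvl hN D hk i') / ((((ℓ + 1 : ℕ) : ℝ)) ^ (lvl hN D hk i')) ^ 2 := by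
  have h := (hB i').2
  have hL0 : (0 : ℝ) < (((ℓ + 1 : ℕ) : ℝ)) ^ (lvl hN D hk i') := by positivity
  have hq : (0 : ℝ) < (cf / (((ℓ + 1 : ℕ) : ℝ)) ^ (i'.1.1 : ℕ)) ^ 2 := by
    have : cf / (((ℓ + 1 : ℕ) : ℝ)) ^ (i'.1.1 : ℕ) ≠ 0 := div_ne_zero hcf (by positivity)
    positivity
  rw [div_le_iff₀ hq] at h
  rw [pow_right_comm (((ℓ + 1 : ℕ) : ℝ)) (d + 1) (lvl hN D hk i')]
  show w i' ≤ b₁ * cf ^ 2 * ((((ℓ + 1 : ℕ) : ℝ)) ^ (i'.1.1 : ℕ)) ^ (d + 1) / ((((ℓ + 1 : ℕ) : ℝ)) ^ (i'.1.1 : ℕ)) ^ 2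
  refine h.trans (le_of_eq ?_)
  rw [div_pow]
  field_simp

/-- **PROPOSITION 2.7 (2.149) AT `k` LEVELS, UNCONDITIONAL**: `B6Prop27KLevelV1L0.prop27_kLevel` with its global coercivity hypothesis
DISCHARGED by `qgq_coercive_kLevel` (`γ = γ₀(d, L, b₁)`, k-uniform): on ROUTE V's torus, for `L ≥ 5` and the standing side
conditions of the k-level (2.142), the kernel of `(QGQ*)⁻¹` decays exponentially in the scaled distance with k-uniform constants.
[cite: Balaban1984PropagatorsII, Proposition 2.7 (2.149) p.249] -/
theorem prop27_kLevel_unconditional (d ℓ : ℕ) (hd : 1 ≤ d + 1) (hL : Odd (ℓ + 1) ∧ 1 < ℓ + 1) {b₀ b₁ : ℝ} (hb₀ : 0 < b₀) (hb₁ : b₀ ≤ b₁) :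
    ∃ σ₁ : ℝ, 0 < σ₁ ∧ ∀ (σ : ℝ), 0 < σ → σ ≤ σ₁ → ∀ (α : ℝ), 0 < α → α < 1 →
    ∃ (A' M₂ c : ℝ) (N₁ : ℕ), 0 < A' ∧ 0 < M₂ ∧ 0 ≤ c ∧
    ∀ (m K : ℕ) {Mh k R : ℕ} {P' : Fin (d + 1) → ℕ}
      (hN : ∀ μ, N0 ℓ Mh k P' μ = (PV d ℓ m K hd hL).sitesPerDir 0) (D : B6MultiLevelTorusOperatorL0.TDomains d ℓ Mh k P' R) (hk : k ≤ m + K) (_ : 2 ≤ k)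
      {a : ℕ} (_ : Mh = (ℓ + 1) ^ a) (_ : 8 ≤ Mh) (_ : 2 * (ℓ + 1) ^ 2 ≤ R) (_ : ∀ μ, 5 ≤ P' μ) (_ : 4 ≤ ℓ)
      (_ : ∀ c : ↥(cubes D.toDomains), Placed ℓ k P' c.1) (_ : M₂ ≤ ((ℓ : ℝ) + 1) * Mh) (_ : N₁ + 1 ≤ R * ((ℓ + 1) * Mh))
      {cf : ℝ} (hcf : cf ≠ 0) {w : BondIdx (domT hN D hk) → ℝ} (hw : ∀ i, 0 < w i) (_ : GlobalBand b₀ b₁ cf w),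
      ∀ i i' : BondIdx (domT hN D hk),
        |⟪EuclideanSpace.single i (1 : ℝ), EE (domT hN D hk) hcf hw (EuclideanSpace.single i' (1 : ℝ))⟫_ℝ| ≤
          (lam hN D hk cf i)⁻¹ * (lam hN D hk cf i')⁻¹ * (2 / gam0 d ℓ b₁ *
            Real.exp (-(min (delta3 α (2 * σ) / 4) (gam0 d ℓ b₁ / A' / (2 * (1 * (4 / delta3 α (2 * σ)) * (2 * ((d : ℝ) + 1) * c)) + 1)) *
              (geomT D).dist (β hN D hk i) (β hN D hk i')))) := by
  obtain ⟨σ₁, hσ₁, h⟩ := B6Prop27KLevelV1L0.prop27_kLevel d ℓ hd hL hb₀ hb₁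
  refine ⟨σ₁, hσ₁, fun σ hσ hσ1 α hα hα1 => ?_⟩
  obtain ⟨A', M₂, c, N₁, hA', hM₂, hc, hmain⟩ := h σ hσ hσ1 α hα hα1
  refine ⟨A', M₂, c, N₁, hA', hM₂, hc, ?_⟩
  intro m K Mh k R P' hN D hk hk2 a hMh hMh8 hR hP' hℓ hPl hM₂' hN₁ cf hcf w hw hB i i'
  have hb₁0 : 0 ≤ b₁ := le_trans hb₀.le hb₁
  have hRM : 2 ≤ R * Mh := by nlinarith
  exact hmain m K hN D hk hk2 hMh hMh8 hR hP' hℓ hPl hM₂' hN₁ hcf hw hB (gam0_pos d ℓ hb₁0)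
    (qgq_coercive_kLevel hN D hk hℓ hRM hcf hb₁0 hw (hwup_of_globalBand hN D hk hcf hB)) i i'

end Final

end

end Literature.MathematicalPhysics.QuantumFieldTheory.Balaban1983to89.B6QGQCoerciveKLevelV1L0
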